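import Literature.NumberTheory.Sieve.BoundedGapsNumberFields
import Literature.NumberTheory.Sieve.MaynardTaoTheoremProofs
import Literature.NumberTheory.Sieve.MaynardK105
import Literature.NumberTheory.Sieve.ParityWave0Proofs
import Mathlib.RingTheory.DedekindDomain.Factorization
import Mathlib.NumberTheory.NumberField.Discriminant.Basic
import Mathlib.RingTheory.ClassGroup.Basic
import Literature.Algebra.EuclideanLattices.LatticeCosetPointCounting
import Mathlib.Algebra.CharP.Quotient
import Mathlib.NumberTheory.NumberField.DedekindZeta
import Mathlib.NumberTheory.NumberField.CanonicalEmbedding.ConvexBody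
import Mathlib.NumberTheory.NumberField.Norm
import Literature.Algebra.EuclideanLattices.LatticeBoxPointCounting
import HarnessLib

/-!
# Bounded gaps between prime elements of number fields — proofs (Castillo et al. 2015, Thm 1.1)

Companion ("Proofs") file of `BoundedGapsNumberFields.lean`, towards discharging the named fact
`Literature.NumberTheory.Sieve.castilloEtAl2015_thm_1_1_totallyReal` (A. Castillo, C. Hall,
R. J. Lemke Oliver, P. Pollack, L. Thompson, *Bounded gaps between primes in number fields and function
fields*, Proc. Amer. Math. Soc. 143 (2015) 2841–2856 = arXiv:1403.5808, Theorem 1.1 with Remark 1,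
assembled in §3.1 from Corollary 2.6, Theorem 2.7 (Hinz) and Maynard's `M₁₀₅ > 4`).

The printed proof (§2: the Maynard–Tao sieve over a Dedekind domain `A` with finite quotients whose
primes have a level of distribution; §2.3 Corollary 2.6; Theorem 2.7 = Hinz's Bombieri–Vinogradov
theorem for totally real fields; §3.1) is followed here bottom-up. This file lands its first steps:

* **the reductions** (§1 conventions / §3.1, "k ≥ k₀"): admissibility and the conclusion are monotone
  in the tuple, so the fact for `|H| ≥ 105` reduces to `|H| = 105`
  (`CastilloEtAl2015.infinite_of_forall_card_eq`), and both hypothesis and conclusion transport along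
  ring isomorphisms (`CastilloEtAl2015.infinite_of_ringEquiv`); and the first line of §2.2, the
  `W`-trick class `v₀ mod 𝔴` making every `α + hᵢ` a unit mod `𝔴` (`CastilloEtAl2015.exists_wTrick_class`,
  CRT in a Dedekind domain);
* **the case `A = ℤ`, i.e. `K = ℚ`** (the paper's first dictionary entry, §2.1, for which Corollary 2.6
  is Maynard's theorem: level `θ < 1/2` by Bombieri–Vinogradov and `M₁₀₅ > 4`, so
  `r₁₀₅ = ⌈θ M₁₀₅/2⌉ ≥ 2`): `CastilloEtAl2015.infinite_int` and, through `𝓞 ℚ ≃+* ℤ`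
  (`Rat.ringOfIntegersEquiv`), `castilloEtAl2015_thm_1_1_rat` — the statement of the fact VERBATIM
  for the totally real field `K = ℚ`. All inputs are theorems of the tree: Maynard's Proposition 4.2
  (`frequently_card_primes_ge_of_maynardFunctional_holds`, `MaynardTaoTheoremProofs.lean`),
  `M₁₀₅ > 4` (`exists_four_lt_maynardFunctional_holds`, `MaynardK105.lean`) and Bombieri–Vinogradov
  (`bombieriVinogradovStatement_of_bombieri_vinogradov`, `bombieri_vinogradov_of_siegelWalfisz`,
  `LFunctions.siegel_walfisz_holds`).

* **§2.1 for `A = 𝓞_K`** (second part of the file, namespace `CastilloEtAl2015`): the boxes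
  `box₀ K N = A₀(N)`, `box K N = A(N)` via the Minkowski embedding (`unitBox`, `mem_box₀`), their
  finiteness / monotonicity / dyadic disjointness (`finite_box₀`, `box₀_mono`, `disjoint_box`), and
  for totally real `K` the residue-class count
  `#{α ∈ A₀(N) : α ≡ α₀ (𝔮)} = N^d/(N𝔮 √|D_K|) + O_𝔮(N^{d−1})` uniformly in `α₀`
  (`abs_card_box₀_coset_sub_le`, `abs_card_box₀_sub_le`; volume `1` of the unit box, covolume
  `N𝔮 √|D_K|` of the ideal lattice, Lipschitz-parametrizable frontier `lipschitzFrontier_unitBox`),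
  from the tree's coset lattice-point theorem (`Algebra/EuclideanLattices/LatticeCosetPointCounting`);
  plus two generic steps of §§2.2–2.3: `exists_lt_card_of_sum_pos` ("`S₂ > ρS₁` ⇒ more than `ρ`
  primes for some `α`") and `infinite_of_forall_exists_mem_box` ("for all large `N` ⇒ infinitely
  many `α`", by disjointness of the boxes `A(2^j N₀)`), combined into the logical skeleton of
  Corollary 2.6 (`infinite_setOf_lt_card_of_sieve`, `infinite_setOf_le_card_of_sieve`: weights with
  `S₂ > ρ S₁` in every large box ⇒ infinitely many `α` with more than `ρ` primes among `α + hᵢ`);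
* **Lemma 3.1** (`admissible_intCast_of_isAdmissibleTuple`): an admissible tuple of `ℤ` (the tree's
  `IsAdmissibleTuple`) is admissible in every commutative ring, in particular in every `𝓞_K`.
* **§2.1 uniformly in `𝔮`** (`abs_card_box₀_coset_sub_le_uniform`, section `UniformCount`): for
  totally real `K` there is `C = C(K)` with
  `|#{α ∈ A₀(N) : α ≡ α₀ (𝔮)} − N^d/(N𝔮 √|D_K|)| ≤ C (1 + (N^d/N𝔮)^{1−1/d})` for ALL nonzero `𝔮`,
  `N ≥ 1`, `α₀` — the printed `|∂A(N, 𝔮)| ≪ 1 + (|A(N)|/|𝔮|)^{1−1/d}` — via a Minkowski-short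
  `x₁ ∈ 𝔮`, the splitting into cosets of `x₁𝓞_K`, and the uniform box count for the fixed lattice
  `ι(𝓞_K) ⊂ ℝ^{r₁}` (`Literature/Algebra/EuclideanLattices/LatticeBoxPointCounting.lean`).
  The `A(N)`-form (`abs_card_box_coset_sub_le_uniform`, main term `(2^d − 1)N^d/(N𝔮√|D_K|)`) follows
  by subtracting the counts on `A₀(2N) ⊇ A₀(N)` (`card_box_coset_eq`).
* **`Δ = 1`** (end of the proof of Corollary 2.6): `tendsto_delta_of_asymptotics` (abstract) and
  `tendsto_delta_totallyReal` — with `c_A = dedekindZeta_residue K` (Mathlib's class number formula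
  constant) and the two displayed asymptotics of §2.3 for `|A(N)|` and `|P(N)|` as hypotheses,
  `c_A |P(N)| log|A(N)|/|A(N)| → 1`; the "some algebra" is `c_A · w(1−2^{−d})/(2^{r₁}hR) = (1−2^{−d})/√|D|`.

What remains for general totally real `K` (not in the tree, see the module docstring of
`BoundedGapsNumberFields.lean`): the sieve of §2.2 over `𝓞_K` (Lemmas 2.2–2.5, Proposition 2.1;
the Mertens / Euler-product estimates over prime ideals it uses are in
`Literature/NumberTheory/LFunctions/MertensPrimeIdeals.lean`), Corollary 2.6 (Mitsui's prime number theorem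
for prime elements in boxes and the Dedekind residue, `Δ = 1`) and Theorem 2.7 (Hinz 1988).

## References

* A. Castillo, C. Hall, R. J. Lemke Oliver, P. Pollack, L. Thompson, *Bounded gaps between primes in
  number fields and function fields*, Proc. Amer. Math. Soc. 143 (2015), 2841–2856,
  doi:10.1090/s0002-9939-2015-12554-3 = arXiv:1403.5808: §1 (conventions, Theorem 1.1, Remark 1),
  §2.1 (the dictionary, `A = ℤ`), Corollary 2.6, Theorem 2.7, §3.1. [CastilloEtAl2015]
* J. Maynard, *Small gaps between primes*, Ann. of Math. (2) 181 (2015), 383–413, Propositions 4.2,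
  4.3. [MaynardAnnals2015]
* D. A. Marcus, *Number Fields*, 2nd ed., Springer 2018, Ch. 6, Lemma 2; S. Lang, *Algebraic Number
  Theory*, GTM 110, Ch. VI §2, Theorem 2 (lattice points in expanding domains, via the tree's
  `Literature.Algebra.EuclideanLattices`). [Marcus2018]
-/

open Finset Filter

namespace Literature.NumberTheory.Sieve

namespace CastilloEtAl2015

variable {R S : Type*} [CommRing R] [CommRing S]

/-- Admissibility in the sense of the paper (§1: `{h₁,…,h_k} mod 𝔭` is not all of `A/𝔭` for each prime
ideal `𝔭`, rendered as "some residue class `a mod P` is missed") is inherited by sub-tuples.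
[cite: CastilloEtAl2015, §1 (definition of admissible)] -/
theorem admissible_mono {H H' : Finset R} (hsub : H' ⊆ H)
    (hH : ∀ P : Ideal R, P.IsPrime → ∃ a : R, ∀ h ∈ H, a - h ∉ P) :
    ∀ P : Ideal R, P.IsPrime → ∃ a : R, ∀ h ∈ H', a - h ∉ P := fun P hP =>
  (hH P hP).imp fun _ ha h hh => ha h (hsub hh)

/-- Two primes in a translate of a sub-tuple are two primes in the same translate of the tuple.
[cite: CastilloEtAl2015, Theorem 1.1 (the conclusion for m = 2)] -/
theorem setOf_twoPrimes_mono {H H' : Finset R} (hsub : H' ⊆ H) :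
    {α : R | ∃ h₁ ∈ H', ∃ h₂ ∈ H', h₁ ≠ h₂ ∧ Prime (α + h₁) ∧ Prime (α + h₂)} ⊆
      {α : R | ∃ h₁ ∈ H, ∃ h₂ ∈ H, h₁ ≠ h₂ ∧ Prime (α + h₁) ∧ Prime (α + h₂)} :=
  fun _ ⟨h₁, h₁m, h₂, h₂m, hne, hp₁, hp₂⟩ => ⟨h₁, hsub h₁m, h₂, hsub h₂m, hne, hp₁, hp₂⟩

/-- **Reduction `k ≥ 105 ⟸ k = 105`** (the form "`k ≥ k₀`" of Theorem 1.1 from the case `k = k₀`, which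
is what Corollary 2.6 with `k = 105` yields in §3.1): an admissible `H` with `|H| ≥ 105` contains an
admissible `105`-element sub-tuple, and the conclusion ascends. [cite: CastilloEtAl2015, Theorem 1.1 and §3.1] -/
theorem infinite_of_forall_card_eq
    (h105 : ∀ H : Finset R, H.card = 105 →
      (∀ P : Ideal R, P.IsPrime → ∃ a : R, ∀ h ∈ H, a - h ∉ P) →
        {α : R | ∃ h₁ ∈ H, ∃ h₂ ∈ H, h₁ ≠ h₂ ∧ Prime (α + h₁) ∧ Prime (α + h₂)}.Infinite)
    (H : Finset R) (hcard : 105 ≤ H.card)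
    (hH : ∀ P : Ideal R, P.IsPrime → ∃ a : R, ∀ h ∈ H, a - h ∉ P) :
    {α : R | ∃ h₁ ∈ H, ∃ h₂ ∈ H, h₁ ≠ h₂ ∧ Prime (α + h₁) ∧ Prime (α + h₂)}.Infinite := by
  obtain ⟨H', hsub, hcard'⟩ := Finset.exists_subset_card_eq hcard
  exact (h105 H' hcard' (admissible_mono hsub hH)).mono (setOf_twoPrimes_mono hsub)

/-- **Transport along a ring isomorphism** `e : R ≃+* S`: admissibility of `H ⊆ R` gives admissibility
of `e(H) ⊆ S` (pull the prime ideal back along `e`), and two primes in a translate of `e(H)` pull back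
to two primes in a translate of `H` (`e` preserves primes). Used with `𝓞 ℚ ≃+* ℤ`.
[cite: CastilloEtAl2015, §2.1 (the dictionary A = ℤ, 𝓞_K)] -/
theorem infinite_of_ringEquiv (e : R ≃+* S) {k : ℕ}
    (hS : ∀ H : Finset S, H.card = k →
      (∀ P : Ideal S, P.IsPrime → ∃ a : S, ∀ h ∈ H, a - h ∉ P) →
        {α : S | ∃ h₁ ∈ H, ∃ h₂ ∈ H, h₁ ≠ h₂ ∧ Prime (α + h₁) ∧ Prime (α + h₂)}.Infinite)
    (H : Finset R) (hcard : H.card = k)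
    (hH : ∀ P : Ideal R, P.IsPrime → ∃ a : R, ∀ h ∈ H, a - h ∉ P) :
    {α : R | ∃ h₁ ∈ H, ∃ h₂ ∈ H, h₁ ≠ h₂ ∧ Prime (α + h₁) ∧ Prime (α + h₂)}.Infinite := by
  set H' : Finset S := H.map e.toEquiv.toEmbedding with hH'def
  have hcard' : H'.card = k := by rw [hH'def, Finset.card_map, hcard]
  have hadm' : ∀ P : Ideal S, P.IsPrime → ∃ a : S, ∀ h ∈ H', a - h ∉ P := by
    intro P hP
    obtain ⟨a, ha⟩ := hH (P.comap (e : R →+* S)) (Ideal.comap_isPrime _ _)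
    refine ⟨e a, fun h hh => ?_⟩
    rw [hH'def, Finset.mem_map] at hh
    obtain ⟨g, hg, rfl⟩ := hh
    have hga := ha g hg
    rw [Ideal.mem_comap, RingHom.coe_coe, map_sub] at hga
    exact hga
  refine Set.infinite_of_injOn_mapsTo (f := fun β : S => e.symm β) (e.symm.injective.injOn)
    ?_ (hS H' hcard' hadm')
  rintro β ⟨h₁, h₁m, h₂, h₂m, hne, hp₁, hp₂⟩
  rw [hH'def, Finset.mem_map] at h₁m h₂m
  obtain ⟨g₁, hg₁, rfl⟩ := h₁m
  obtain ⟨g₂, hg₂, rfl⟩ := h₂m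
  refine ⟨g₁, hg₁, g₂, hg₂, fun h => hne (by rw [h]), ?_, ?_⟩
  · rw [← MulEquiv.prime_iff e]
    simpa using hp₁
  · rw [← MulEquiv.prime_iff e]
    simpa using hp₂

/-- **The `W`-trick residue class** (§2.2: "`v₀` is a residue class modulo `𝔴` chosen so that each
`α + hᵢ` lies in `(A/𝔴)ˣ`"): in a Dedekind domain `A`, for an admissible `H` and any nonzero ideal `𝔴`
there is `v₀` such that `α + h ∉ 𝔭` for every `α ≡ v₀ (mod 𝔭)`, every prime `𝔭 ∣ 𝔴` and every `h ∈ H`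
(CRT over the finitely many primes dividing `𝔴`, at each of which `H` misses a class).
[cite: CastilloEtAl2015, §2.2 (choice of v₀ mod 𝔴)] -/
theorem exists_wTrick_class {A : Type*} [CommRing A] [IsDedekindDomain A] (H : Finset A)
    (hH : ∀ P : Ideal A, P.IsPrime → ∃ a : A, ∀ h ∈ H, a - h ∉ P) {w : Ideal A} (hw : w ≠ ⊥) :
    ∃ v₀ : A, ∀ P : Ideal A, P.IsPrime → P ∣ w → ∀ α : A, α - v₀ ∈ P → ∀ h ∈ H, α + h ∉ P := by
  classical
  choose a ha using fun v : IsDedekindDomain.HeightOneSpectrum A => hH v.asIdeal v.isPrime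
  set S : Finset (IsDedekindDomain.HeightOneSpectrum A) := (Ideal.finite_factors hw).toFinset with hS
  obtain ⟨y, hy⟩ := IsDedekindDomain.exists_forall_sub_mem_ideal (s := S)
    (fun v : IsDedekindDomain.HeightOneSpectrum A => v.asIdeal) (fun _ => 1) (fun v _ => v.prime)
    (fun v _ v' _ hne heq => hne (IsDedekindDomain.HeightOneSpectrum.ext heq)) (fun v => -a v.1)
  refine ⟨y, fun P hP hdvd α hα h hh hmem => ?_⟩
  have hP0 : P ≠ ⊥ := by
    rintro rfl
    exact hw (zero_dvd_iff.1 hdvd)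
  let v : IsDedekindDomain.HeightOneSpectrum A := ⟨P, hP, hP0⟩
  have hv : v ∈ S := by
    rw [hS, Set.Finite.mem_toFinset]
    exact hdvd
  have hyv : y - -a v ∈ P := by simpa using hy v hv
  refine ha v h hh ?_
  have hid : a v - h = (y - -a v) + (α - y) - (α + h) := by ring
  rw [hid]
  exact P.sub_mem (P.add_mem hyv hα) hmem

/-- A positive integer whose `toNat` is a prime number is a prime element of `ℤ` (bridging the
counting convention of `frequently_card_primes_ge_of_maynardFunctional` to `Prime`). [folklore] -/
theorem prime_of_toNat_prime {z : ℤ} (h : 0 < z ∧ z.toNat.Prime) : Prime z := by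
  rw [Int.prime_iff_natAbs_prime]
  have hz : z.natAbs = z.toNat := by omega
  rw [hz]
  exact h.2

/-- The paper's admissibility (every prime ideal of `ℤ` misses a residue class of `H`) implies the
tree's `IsAdmissibleTuple H` (`ν_H(p) < p` for every prime `p`): modulo `(p)` the missed class
`a mod p` is not in the image of `H`. [cite: CastilloEtAl2015, §1 (admissible, A = ℤ)] -/
theorem isAdmissibleTuple_of_forall_ideal {H : Finset ℤ}
    (hH : ∀ P : Ideal ℤ, P.IsPrime → ∃ a : ℤ, ∀ h ∈ H, a - h ∉ P) : IsAdmissibleTuple H := by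
  intro p hp
  haveI := Fact.mk hp
  have hPr : (Ideal.span {(p : ℤ)}).IsPrime := by
    rw [Ideal.span_singleton_prime (by exact_mod_cast hp.ne_zero)]
    exact Nat.prime_iff_prime_int.1 hp
  obtain ⟨a, ha⟩ := hH (Ideal.span {(p : ℤ)}) hPr
  have hsub : H.image (fun h : ℤ => (h : ZMod p)) ⊆ Finset.univ.erase (a : ZMod p) := by
    intro x hx
    rw [Finset.mem_image] at hx
    obtain ⟨h, hh, rfl⟩ := hx
    rw [Finset.mem_erase]
    refine ⟨fun heq => ha h hh ?_, Finset.mem_univ _⟩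
    rw [Ideal.mem_span_singleton]
    exact (ZMod.intCast_eq_intCast_iff_dvd_sub h a p).1 heq
  unfold tupleResidueCount
  calc (H.image fun h : ℤ => (h : ZMod p)).card ≤ (Finset.univ.erase (a : ZMod p)).card :=
        Finset.card_le_card hsub
    _ = p - 1 := by rw [Finset.card_erase_of_mem (Finset.mem_univ _), Finset.card_univ, ZMod.card]
    _ < p := Nat.sub_lt hp.pos one_pos

/-- **The case `A = ℤ` of Corollary 2.6 with `k = 105`, `r₁₀₅ ≥ 2`** (= Maynard 2015 for admissible
`105`-tuples, in the format of Theorem 1.1): for every `105`-element `H ⊆ ℤ` missing a residue class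
modulo every prime ideal, there are infinitely many `α ∈ ℤ` with `α + h₁`, `α + h₂` both prime for two
distinct `h₁, h₂ ∈ H`. Proof as printed in §3.1 for totally real `K`, specialised to `K = ℚ`:
Bombieri–Vinogradov gives level `θ` for every `θ < 1/2` (the `A = ℤ` entry of §2.1), Maynard's
`M₁₀₅ > 4` (`exists_four_lt_maynardFunctional_holds`), and with `2/M₁₀₅ < θ < 1/2` Maynard's
Proposition 4.2 (`frequently_card_primes_ge_of_maynardFunctional_holds`, `m = 1`) yields `≥ 2` primes
among `n + hᵢ` for infinitely many `n ∈ ℕ`. [cite: CastilloEtAl2015, Corollary 2.6 and §3.1 (A = ℤ)] -/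
theorem infinite_int (H : Finset ℤ) (hcard : H.card = 105)
    (hH : ∀ P : Ideal ℤ, P.IsPrime → ∃ a : ℤ, ∀ h ∈ H, a - h ∉ P) :
    {α : ℤ | ∃ h₁ ∈ H, ∃ h₂ ∈ H, h₁ ≠ h₂ ∧ Prime (α + h₁) ∧ Prime (α + h₂)}.Infinite := by
  have hadm : IsAdmissibleTuple H := isAdmissibleTuple_of_forall_ideal hH
  -- `M₁₀₅ > 4` and a level `θ` with `2/M < θ < 1/2`
  obtain ⟨F, hF, hM⟩ := exists_four_lt_maynardFunctional_holds
  set M : ℝ := maynardFunctional 105 F with hMdef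
  set θ : ℝ := (2 / M + 1 / 2) / 2 with hθdef
  have hM0 : 0 < M := lt_trans (by norm_num) hM
  have h2M : 2 / M < 1 / 2 := by rw [div_lt_div_iff₀ hM0 (by norm_num)]; linarith
  have h2M0 : 0 < 2 / M := by positivity
  have hθlo : 2 / M < θ := by rw [hθdef]; linarith
  have hθhi : θ < 1 / 2 := by rw [hθdef]; linarith
  have hθ0 : 0 < θ := lt_trans h2M0 hθlo
  -- Bombieri–Vinogradov (the `A = ℤ` level of distribution of §2.1)
  have hBV : BombieriVinogradovStatement :=
    bombieriVinogradovStatement_of_bombieri_vinogradov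
      (bombieri_vinogradov_of_siegelWalfisz LFunctions.siegel_walfisz_holds)
  have hlevel : PrimesHaveLevel θ := hBV θ hθhi
  have hMθ : 2 * ((1 : ℕ) : ℝ) / θ < maynardFunctional 105 F := by
    rw [Nat.cast_one, mul_one, div_lt_iff₀ hθ0, ← hMdef]
    have : 2 / M * M = 2 := by field_simp
    nlinarith
  -- Maynard's Proposition 4.2 with `m = 1`, `k = 105`
  have hfreq := frequently_card_primes_ge_of_maynardFunctional_holds θ hθ0 hlevel 1 105 F hF hMθ H
    hadm hcard
  have hinf := Nat.frequently_atTop_iff_infinite.1 hfreq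
  refine Set.infinite_of_injOn_mapsTo (f := fun n : ℕ => (n : ℤ)) Nat.cast_injective.injOn ?_ hinf
  intro n hn
  have hn' : 1 < (H.filter fun h => 0 < (n : ℤ) + h ∧ ((n : ℤ) + h).toNat.Prime).card := by
    have := hn
    simp only [Set.mem_setOf_eq] at this
    omega
  obtain ⟨h₁, h₁m, h₂, h₂m, hne⟩ := Finset.one_lt_card.1 hn'
  rw [Finset.mem_filter] at h₁m h₂m
  exact ⟨h₁, h₁m.1, h₂, h₂m.1, hne, prime_of_toNat_prime h₁m.2, prime_of_toNat_prime h₂m.2⟩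

/-! ## Lemma 3.1: admissible in `ℤ` ⇒ admissible in every `𝓞_K` -/


/-- **Lemma 3.1** ("Suppose that `𝓗` is an admissible tuple in `ℤ`. Then `𝓗` is also an admissible
tuple in `𝓞_K` for every number field `K`"), in fact for every commutative ring `R` in place of
`𝓞_K`: modulo a prime ideal `P` the characteristic `p` of `R/P` is `0` or a prime; if `p` is prime,
a class `c mod p` missed by `𝓗` in `ℤ/p` (admissibility in `ℤ`) is missed by `𝓗` modulo `P`
(`c − h ∈ P` forces `p ∣ c − h`), and if `p = 0` any integer `c ∉ 𝓗` will do. (The printed proof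
argues with the prime subfield of `𝓞_K/𝔭`; this is the same argument without the case distinction
on the residue degree.) [cite: CastilloEtAl2015, Lemma 3.1] -/
theorem admissible_intCast_of_isAdmissibleTuple {R : Type*} [CommRing R] [DecidableEq R]
    {H : Finset ℤ} (hH : IsAdmissibleTuple H) :
    ∀ P : Ideal R, P.IsPrime → ∃ a : R, ∀ h ∈ H.image (Int.cast : ℤ → R), a - h ∉ P := by
  intro P hP
  classical
  haveI := Ideal.Quotient.isDomain P
  set p := ringChar (R ⧸ P) with hp
  -- `c − h ∈ P` means `p ∣ c − h`
  have key : ∀ c h : ℤ, (c : R) - (h : R) ∈ P → (p : ℤ) ∣ c - h := by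
    intro c h hch
    have h0 : ((c - h : ℤ) : R ⧸ P) = 0 := by
      rw [show ((c - h : ℤ) : R ⧸ P) = Ideal.Quotient.mk P ((c : R) - (h : R)) by push_cast; rfl]
      exact Ideal.Quotient.eq_zero_iff_mem.2 hch
    exact (CharP.intCast_eq_zero_iff (R ⧸ P) p _).1 h0
  rcases CharP.char_is_prime_or_zero (R ⧸ P) p with hprime | hzero
  · -- a class `c mod p` missed by `H`
    haveI := Fact.mk hprime
    have hlt : (H.image fun h : ℤ => (h : ZMod p)).card < (Finset.univ : Finset (ZMod p)).card := by
      rw [Finset.card_univ, ZMod.card]; exact hH p hprime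
    obtain ⟨c, -, hc⟩ := Finset.exists_mem_notMem_of_card_lt_card hlt
    refine ⟨((c.val : ℤ) : R), fun x hx hmem => ?_⟩
    rw [Finset.mem_image] at hx
    obtain ⟨h, hh, rfl⟩ := hx
    have hdvd := key _ _ hmem
    refine hc (Finset.mem_image.2 ⟨h, hh, ?_⟩)
    have hc' := (ZMod.intCast_eq_intCast_iff_dvd_sub h (c.val : ℤ) p).2 hdvd
    rw [hc', Int.cast_natCast, ZMod.natCast_zmod_val]
  · -- characteristic `0`: any integer not in `H`
    haveI : CharP (R ⧸ P) 0 := hzero ▸ (inferInstance : CharP (R ⧸ P) p)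
    obtain ⟨c, hc⟩ := Infinite.exists_notMem_finset H
    refine ⟨(c : R), fun x hx hmem => ?_⟩
    rw [Finset.mem_image] at hx
    obtain ⟨h, hh, rfl⟩ := hx
    have hdvd := key _ _ hmem
    rw [hzero, Nat.cast_zero, zero_dvd_iff, sub_eq_zero] at hdvd
    exact hc (hdvd ▸ hh)


/-! ## §2.1 for `A = 𝓞_K`: the boxes `A₀(N)`, `A(N)` and the lattice-point count

The dictionary of §2.1 for a number field: `A₀(N) = {α ∈ 𝓞_K : 0 < σ(α) ≤ N (σ real),
|σ(α)| ≤ N (σ complex)}`, `A(N) = A₀(2N) ∖ A₀(N)`, realised through Mathlib's Minkowski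
embedding `mixedEmbedding K : K →+* ℝ^{r₁} × ℂ^{r₂}` (`A₀(N) = ι⁻¹(N • unitBox)`), and — for
totally real `K`, the case of the fact — the count of a residue class `α₀ mod 𝔮` in `A₀(N)`:
`N^d/(N𝔮 √|D_K|) + O_𝔮(N^{d−1})` uniformly in `α₀` (the display of §2.1 with Lang's boundary
term; the uniformity in `𝔮` claimed there, `O(1 + (|A(N)|/|𝔮|)^{1−1/d})`, is NOT proved here), from
the coset lattice-point theorem `Literature.Algebra.EuclideanLattices.abs_card_inter_smul_vadd_sub_le`
(Marcus Ch. 6 Lemma 2 / Lang VI §2 Thm 2) applied to the ideal lattice `ι(𝔮)` (covolume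
`N𝔮 · √|D_K|`, Mathlib `covolume_idealLattice`) and the unit box, whose frontier is covered by the
`2 r₁` faces `{x_w = 0, 1}` (`lipschitzFrontier_unitBox`). Also: finiteness and disjointness of the
boxes, the step "an `α` in every large box ⇒ infinitely many `α`" of the proof of Corollary 2.6,
and the positivity step "`S₂ > ρ S₁` ⇒ some `α` has more than `ρ` primes" of §2.2. -/

section Boxes

open NumberField NumberField.InfinitePlace NumberField.mixedEmbedding Set MeasureTheory Bornology
open scoped nonZeroDivisors Pointwise Classical

variable (K : Type*) [Field K] [NumberField K]

/-- The paper's box `A₀(N)` (§2.1): the `α ∈ 𝓞_K` with `0 < σ(α) ≤ N` at every real embedding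
`σ` and `|σ(α)| ≤ N` at every complex one. [cite: CastilloEtAl2015, §2.1 (definition of A₀(N))] -/
def box₀ (N : ℝ) : Set (𝓞 K) :=
  {α | (∀ w : {w : InfinitePlace K // w.IsReal}, (mixedEmbedding K (α : K)).1 w ∈ Ioc 0 N) ∧
    ∀ w : {w : InfinitePlace K // w.IsComplex}, ‖(mixedEmbedding K (α : K)).2 w‖ ≤ N}

/-- The paper's "box of size `N`", `A(N) := A₀(2N) ∖ A₀(N)` (§2.1).
[cite: CastilloEtAl2015, §2.1 (definition of A(N))] -/
def box (N : ℝ) : Set (𝓞 K) := box₀ K (2 * N) \ box₀ K N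

/-- The region of the mixed space `ℝ^{r₁} × ℂ^{r₂}` cut out by the conditions of `A₀(1)`:
real coordinates in `(0, 1]`, complex coordinates of modulus `≤ 1`; `A₀(N)` is the set of
`α ∈ 𝓞_K` whose image lies in `N • unitBox`. [cite: CastilloEtAl2015, §2.1 and §2.3 (the region in Minkowski space)] -/
def unitBox : Set (mixedSpace K) :=
  (Set.univ.pi fun _ => Ioc (0 : ℝ) 1) ×ˢ (Set.univ.pi fun _ => Metric.closedBall (0 : ℂ) 1)

variable {K}

omit [NumberField K] in
/-- Membership in the unit box, unfolded. [folklore] -/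
theorem mem_unitBox {x : mixedSpace K} :
    x ∈ unitBox K ↔ (∀ w, x.1 w ∈ Ioc (0 : ℝ) 1) ∧ ∀ w, ‖x.2 w‖ ≤ 1 := by
  simp [unitBox, Set.mem_pi]

omit [NumberField K] in
/-- Membership in the dilate `N • unitBox`: real coordinates in `(0, N]`, complex coordinates of
modulus `≤ N`. [folklore] -/
theorem mem_smul_unitBox {N : ℝ} (hN : 0 < N) {x : mixedSpace K} :
    x ∈ N • unitBox K ↔ (∀ w, x.1 w ∈ Ioc (0 : ℝ) N) ∧ ∀ w, ‖x.2 w‖ ≤ N := by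
  rw [Set.mem_smul_set_iff_inv_smul_mem₀ hN.ne', mem_unitBox]
  simp only [Prod.smul_fst, Prod.smul_snd, Pi.smul_apply, smul_eq_mul, Set.mem_Ioc, _root_.norm_smul,
    norm_inv, Real.norm_eq_abs, abs_of_pos hN]
  refine and_congr (forall_congr' fun w => ?_) (forall_congr' fun w => ?_)
  · rw [mul_pos_iff_of_pos_left (inv_pos.2 hN), inv_mul_le_iff₀ hN, mul_one]
  · rw [inv_mul_le_iff₀ hN, mul_one]

omit [NumberField K] in
/-- `α ∈ A₀(N) ↔ ι(α) ∈ N • unitBox` (`ι` the Minkowski embedding).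
[cite: CastilloEtAl2015, §2.1 (A₀(N) as a region of Minkowski space)] -/
theorem mem_box₀ {N : ℝ} (hN : 0 < N) {α : 𝓞 K} :
    α ∈ box₀ K N ↔ mixedEmbedding K (α : K) ∈ N • unitBox K := by
  rw [mem_smul_unitBox hN]; rfl

/-- The unit box is bounded. [folklore] -/
theorem isBounded_unitBox : IsBounded (unitBox K) := by
  refine IsBounded.prod ?_ ?_
  · refine (Metric.isBounded_Icc (0 : {w : InfinitePlace K // w.IsReal} → ℝ) 1).subset ?_
    intro x hx
    rw [Set.mem_univ_pi] at hx
    exact ⟨fun w => (hx w).1.le, fun w => (hx w).2⟩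
  · refine (Metric.isBounded_closedBall (x := (0 : {w : InfinitePlace K // w.IsComplex} → ℂ))
      (r := 1)).subset ?_
    rw [closedBall_pi _ zero_le_one]
    exact Set.pi_mono fun w _ => subset_rfl


/-! ### Totally real `K`: no complex places -/

omit [NumberField K] in
/-- A totally real field has no complex places. [folklore] -/
theorem isEmpty_isComplex [IsTotallyReal K] : IsEmpty {w : InfinitePlace K // w.IsComplex} :=
  ⟨fun w => (not_isReal_iff_isComplex.2 w.2) (IsTotallyReal.isReal w.1)⟩

/-- A totally real number field has a real place. [folklore] -/
theorem nonempty_isReal [IsTotallyReal K] : Nonempty {w : InfinitePlace K // w.IsReal} := by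
  obtain ⟨w⟩ := (inferInstance : Nonempty (InfinitePlace K))
  exact ⟨⟨w, IsTotallyReal.isReal w⟩⟩

/-- For totally real `K` the unit box has volume `1` (= the volume `N^d · π^{r₂}` of the region of
§2.3 at `N = 1`, `r₂ = 0`). [cite: CastilloEtAl2015, §2.3 (volume N^d π^{r₂})] -/
theorem volume_unitBox [IsTotallyReal K] : volume (unitBox K) = 1 := by
  haveI := isEmpty_isComplex (K := K)
  have huniv : (Set.univ.pi fun _ : {w : InfinitePlace K // w.IsComplex} =>
      Metric.closedBall (0 : ℂ) 1) = Set.univ :=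
    Set.eq_univ_of_forall fun _ w _ => isEmptyElim w
  rw [unitBox, Measure.volume_eq_prod, Measure.prod_prod, volume_pi_pi, huniv, volume_pi,
    Measure.pi_empty_univ]
  simp only [Real.volume_Ioc, sub_zero, ENNReal.ofReal_one, Finset.prod_const_one, one_mul]

/-- Real-valued form of `volume_unitBox`. [folklore] -/
theorem volume_real_unitBox [IsTotallyReal K] : volume.real (unitBox K) = 1 := by
  rw [measureReal_def, volume_unitBox, ENNReal.toReal_one]

/-! ### The frontier of the box -/

/-- The face `{x_{w₀} = b}` of the closed unit cube, parametrized by the remaining real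
coordinates (complex coordinates set to `0`; there are none for totally real `K`) — the
"translates of the fundamental parallelogram that intersect the boundary" of §2.1 are controlled
through these Lipschitz pieces. [folklore] -/
noncomputable def boxFace (w₀ : {w : InfinitePlace K // w.IsReal}) (b : ℝ)
    (q : {w : {w : InfinitePlace K // w.IsReal} // w ≠ w₀} → ℝ) : mixedSpace K :=
  (fun w => if h : w = w₀ then b else q ⟨w, h⟩, fun _ => 0)

/-- Each face map is `1`-Lipschitz (sup metric). [folklore] -/
theorem lipschitzWith_boxFace (w₀ : {w : InfinitePlace K // w.IsReal}) (b : ℝ) :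
    LipschitzWith 1 (boxFace (K := K) w₀ b) := by
  refine LipschitzWith.of_dist_le_mul fun q q' => ?_
  rw [NNReal.coe_one, one_mul, Prod.dist_eq, max_le_iff]
  refine ⟨?_, ?_⟩
  · refine (dist_pi_le_iff dist_nonneg).2 fun w => ?_
    by_cases h : w = w₀
    · simp [boxFace, h]
    · simp only [boxFace, h, dite_false]
      exact dist_le_pi_dist q q' ⟨w, h⟩
  · simp [boxFace]

/-- For totally real `K` the frontier of the unit box is covered by the `2r₁` faces
`{x_w = 0}`, `{x_w = 1}`. [folklore] -/
theorem frontier_unitBox_subset [IsTotallyReal K] :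
    frontier (unitBox K) ⊆ ⋃ j : {w : InfinitePlace K // w.IsReal} × Fin 2,
      boxFace j.1 ((j.2 : ℕ) : ℝ) '' Icc 0 1 := by
  haveI := isEmpty_isComplex (K := K)
  intro x hx
  -- closure ⊆ closed cube, interior ⊇ open cube
  have hC : IsClosed {x : mixedSpace K | ∀ w, x.1 w ∈ Icc (0 : ℝ) 1} := by
    have : {x : mixedSpace K | ∀ w, x.1 w ∈ Icc (0 : ℝ) 1} =
        Prod.fst ⁻¹' (Set.univ.pi fun _ => Icc (0 : ℝ) 1) := by
      ext x; simp only [Set.mem_setOf_eq, Set.mem_preimage, Set.mem_univ_pi]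
    rw [this]
    exact (isClosed_set_pi fun _ _ => isClosed_Icc).preimage continuous_fst
  have hO : IsOpen {x : mixedSpace K | ∀ w, x.1 w ∈ Ioo (0 : ℝ) 1} := by
    have : {x : mixedSpace K | ∀ w, x.1 w ∈ Ioo (0 : ℝ) 1} =
        Prod.fst ⁻¹' (Set.univ.pi fun _ => Ioo (0 : ℝ) 1) := by
      ext x; simp only [Set.mem_setOf_eq, Set.mem_preimage, Set.mem_univ_pi]
    rw [this]
    exact (isOpen_set_pi Set.finite_univ fun _ _ => isOpen_Ioo).preimage continuous_fst
  have hcl : closure (unitBox K) ⊆ {x : mixedSpace K | ∀ w, x.1 w ∈ Icc (0 : ℝ) 1} :=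
    closure_minimal (fun y hy w => Ioc_subset_Icc_self ((mem_unitBox.1 hy).1 w)) hC
  have hint : {x : mixedSpace K | ∀ w, x.1 w ∈ Ioo (0 : ℝ) 1} ⊆ interior (unitBox K) :=
    interior_maximal (fun y hy => mem_unitBox.2 ⟨fun w => Ioo_subset_Ioc_self (hy w),
      fun w => isEmptyElim w⟩) hO
  have hx1 : ∀ w, x.1 w ∈ Icc (0 : ℝ) 1 := hcl hx.1
  have hx2 : ¬ ∀ w, x.1 w ∈ Ioo (0 : ℝ) 1 := fun h => hx.2 (hint h)
  push Not at hx2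
  obtain ⟨w₀, hw₀⟩ := hx2
  have hb : x.1 w₀ = 0 ∨ x.1 w₀ = 1 := by
    rcases (hx1 w₀) with ⟨h0, h1⟩
    rcases h0.lt_or_eq with h0' | h0'
    · rcases h1.lt_or_eq with h1' | h1'
      · exact absurd ⟨h0', h1'⟩ hw₀
      · exact Or.inr h1'
    · exact Or.inl h0'.symm
  rw [Set.mem_iUnion]
  rcases hb with hb | hb
  · refine ⟨⟨w₀, 0⟩, fun w => x.1 w.1,
      Literature.Algebra.EuclideanLattices.mem_cube_iff.2 fun w => hx1 w.1, ?_⟩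
    refine Prod.ext (funext fun w => ?_) (Subsingleton.elim _ _)
    by_cases h : w = w₀
    · subst h; simp [boxFace, hb]
    · simp [boxFace, h]
  · refine ⟨⟨w₀, 1⟩, fun w => x.1 w.1,
      Literature.Algebra.EuclideanLattices.mem_cube_iff.2 fun w => hx1 w.1, ?_⟩
    refine Prod.ext (funext fun w => ?_) (Subsingleton.elim _ _)
    by_cases h : w = w₀
    · subst h; simp [boxFace, hb]
    · simp [boxFace, h]

/-- For totally real `K`, the unit box has `(d−1)`-Lipschitz-parametrizable frontier in the sense of
`Literature.Algebra.EuclideanLattices.LipschitzFrontier` (Marcus's "sufficiently nice boundary").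
[cite: Marcus2018, Ch. 6, p. 126] -/
theorem lipschitzFrontier_unitBox [IsTotallyReal K] :
    Literature.Algebra.EuclideanLattices.LipschitzFrontier (unitBox K) := by
  haveI := nonempty_isReal (K := K)
  have hcard : ∀ j : {w : InfinitePlace K // w.IsReal} × Fin 2,
      Fintype.card {w : {w : InfinitePlace K // w.IsReal} // w ≠ j.1} = nrRealPlaces K - 1 := by
    intro j
    rw [Fintype.card_subtype_compl, Fintype.card_subtype_eq, nrRealPlaces]
  have hm : nrRealPlaces K - 1 + 1 = Module.finrank ℝ (mixedSpace K) := by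
    rw [mixedEmbedding.finrank, IsTotallyReal.finrank]
    have : 0 < nrRealPlaces K := Fintype.card_pos
    omega
  refine Literature.Algebra.EuclideanLattices.LipschitzFrontier.of_pieces hm hcard
    (K := 1) (f := fun j => boxFace j.1 ((j.2 : ℕ) : ℝ)) (fun j => (lipschitzWith_boxFace _ _).lipschitzOnWith)
    frontier_unitBox_subset


/-! ### Points of a residue class in the box -/

/-- The elements of the residue class `α₀ mod 𝔮` in `A₀(N)` correspond, under the Minkowski
embedding, to the points of the coset `ι(α₀) + ι(𝔮)` of the ideal lattice in `N • unitBox`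
(§2.1: "Under this embedding, `𝔮` goes to a lattice, while the constraints on `A(N)` correspond to a
certain region"). [cite: CastilloEtAl2015, §2.1 (𝔮 as a lattice in Minkowski space)] -/
theorem card_box₀_coset_eq (𝔮 : (Ideal (𝓞 K))⁰) {N : ℝ} (hN : 0 < N) (α₀ : 𝓞 K) :
    Nat.card {α : 𝓞 K // α ∈ box₀ K N ∧ α - α₀ ∈ (𝔮 : Ideal (𝓞 K))} =
      Nat.card ((N • unitBox K) ∩ (mixedEmbedding K (α₀ : K) +ᵥ
        (mixedEmbedding.idealLattice K (FractionalIdeal.mk0 K 𝔮) : Set (mixedSpace K))) :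
          Set (mixedSpace K)) := by
  classical
  set L := mixedEmbedding.idealLattice K (FractionalIdeal.mk0 K 𝔮) with hL
  have hmemL : ∀ β : 𝓞 K, β ∈ (𝔮 : Ideal (𝓞 K)) → mixedEmbedding K (β : K) ∈ L := by
    intro β hβ
    rw [hL, mem_idealLattice]
    refine ⟨(β : K), ?_, rfl⟩
    change (β : K) ∈ ((FractionalIdeal.mk0 K 𝔮 : (FractionalIdeal (𝓞 K)⁰ K)ˣ) : FractionalIdeal (𝓞 K)⁰ K)
    rw [FractionalIdeal.coe_mk0, FractionalIdeal.mem_coeIdeal]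
    exact ⟨β, hβ, rfl⟩
  let f : {α : 𝓞 K // α ∈ box₀ K N ∧ α - α₀ ∈ (𝔮 : Ideal (𝓞 K))} →
      ((N • unitBox K) ∩ (mixedEmbedding K (α₀ : K) +ᵥ (L : Set (mixedSpace K))) :
        Set (mixedSpace K)) := fun α =>
    ⟨mixedEmbedding K (α.1 : K), (mem_box₀ hN).1 α.2.1, Set.mem_vadd_set.2
      ⟨mixedEmbedding K ((α.1 - α₀ : 𝓞 K) : K), hmemL _ α.2.2, by
        rw [vadd_eq_add, ← map_add]; congr 1; push_cast; ring⟩⟩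
  refine Nat.card_congr (Equiv.ofBijective f ⟨?_, ?_⟩)
  · intro a b hab
    have h1 : mixedEmbedding K (a.1 : K) = mixedEmbedding K (b.1 : K) := congrArg Subtype.val hab
    exact Subtype.ext (RingOfIntegers.ext ((mixedEmbedding K).injective h1))
  · rintro ⟨x, hx₁, hx₂⟩
    obtain ⟨ℓ, hℓ, rfl⟩ := Set.mem_vadd_set.1 hx₂
    rw [hL, SetLike.mem_coe, mem_idealLattice] at hℓ
    obtain ⟨y, hy, rfl⟩ := hℓ
    have hy' : y ∈ ((FractionalIdeal.mk0 K 𝔮 : (FractionalIdeal (𝓞 K)⁰ K)ˣ) :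
        FractionalIdeal (𝓞 K)⁰ K) := hy
    rw [FractionalIdeal.coe_mk0, FractionalIdeal.mem_coeIdeal] at hy'
    obtain ⟨β, hβ, rfl⟩ := hy'
    have hx : mixedEmbedding K (α₀ : K) +ᵥ mixedEmbedding K (algebraMap (𝓞 K) K β) =
        mixedEmbedding K ((α₀ + β : 𝓞 K) : K) := by
      rw [vadd_eq_add, ← map_add]; congr 1
    refine ⟨⟨α₀ + β, ?_, by simpa using hβ⟩, Subtype.ext hx.symm⟩
    rw [mem_box₀ hN, ← hx]
    exact hx₁

/-- **The residue-class count in the box, §2.1** ("the number of elements `α ∈ A(N)` satisfying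
`α ≡ α₀ (mod 𝔮)` is `|A(N)|/|𝔮| + O(|∂A(N, 𝔮)|)`", for `A₀(N)` and totally real `K`, with Lang's
boundary term `O_𝔮(N^{d−1})` uniform in the class): for every nonzero ideal `𝔮` of `𝓞_K` there is
`C` with `|#{α ∈ A₀(N) : α ≡ α₀ (mod 𝔮)} − N^d/(N𝔮 √|D_K|)| ≤ C N^{d−1}` for all `N ≥ 1` and all
`α₀`. [cite: CastilloEtAl2015, §2.1 (count of α ∈ A(N), α ≡ α₀ mod 𝔮)] -/
theorem abs_card_box₀_coset_sub_le [IsTotallyReal K] (𝔮 : (Ideal (𝓞 K))⁰) :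
    ∃ C : ℝ, ∀ N : ℝ, 1 ≤ N → ∀ α₀ : 𝓞 K,
      |(Nat.card {α : 𝓞 K // α ∈ box₀ K N ∧ α - α₀ ∈ (𝔮 : Ideal (𝓞 K))} : ℝ) -
          N ^ Module.finrank ℚ K / (Ideal.absNorm (𝔮 : Ideal (𝓞 K)) * √|discr K|)| ≤
        C * N ^ (Module.finrank ℚ K - 1) := by
  classical
  set L : Submodule ℤ (mixedSpace K) := mixedEmbedding.idealLattice K (FractionalIdeal.mk0 K 𝔮)
    with hL
  obtain ⟨C, hC⟩ := Literature.Algebra.EuclideanLattices.abs_card_inter_smul_vadd_sub_le volume L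
    isBounded_unitBox lipschitzFrontier_unitBox
  refine ⟨C, fun N hN α₀ => ?_⟩
  have hN0 : 0 < N := by linarith
  have hcov : ZLattice.covolume L volume = Ideal.absNorm (𝔮 : Ideal (𝓞 K)) * √|discr K| := by
    rw [hL, covolume_idealLattice, IsTotallyReal.nrComplexPlaces_eq_zero, pow_zero, mul_one,
      FractionalIdeal.coe_mk0, FractionalIdeal.coeIdeal_absNorm, Rat.cast_natCast]
  have h := hC N hN (mixedEmbedding K (α₀ : K))
  rw [← card_box₀_coset_eq 𝔮 hN0 α₀, volume_real_unitBox, hcov, mixedEmbedding.finrank,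
    one_div_mul_eq_div] at h
  exact h

/-- **The box count** `|A₀(N)| = N^d/√|D_K| + O(N^{d−1})` for totally real `K` (§2.3: "It follows
that `|A₀(N)| ∼ (2π)^{r₂} N^d/√|D|`", here `r₂ = 0`, with Lang's error term).
[cite: CastilloEtAl2015, §2.3 (|A₀(N)| ∼ (2π)^{r₂}N^d/√|D|)] -/
theorem abs_card_box₀_sub_le [IsTotallyReal K] :
    ∃ C : ℝ, ∀ N : ℝ, 1 ≤ N →
      |(Nat.card (box₀ K N) : ℝ) - N ^ Module.finrank ℚ K / (√|discr K|)| ≤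
        C * N ^ (Module.finrank ℚ K - 1) := by
  obtain ⟨C, hC⟩ := abs_card_box₀_coset_sub_le (K := K) 1
  refine ⟨C, fun N hN => ?_⟩
  have h := hC N hN 0
  have hcard : Nat.card {α : 𝓞 K // α ∈ box₀ K N ∧ α - 0 ∈ ((1 : (Ideal (𝓞 K))⁰) : Ideal (𝓞 K))} =
      Nat.card (box₀ K N) :=
    Nat.card_congr (Equiv.subtypeEquivRight fun α => by simp)
  rw [hcard] at h
  simpa using h


/-! ### Finiteness, monotonicity and disjointness of the boxes -/

/-- For `N ≤ 0` the box `A₀(N)` contains at most `0`. [folklore] -/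
theorem box₀_subset_zero {N : ℝ} (hN : N ≤ 0) : box₀ K N ⊆ {0} := by
  intro α hα
  rw [Set.mem_singleton_iff, ← RingOfIntegers.coe_eq_zero_iff, ← map_eq_zero_iff _
    (mixedEmbedding K).injective]
  refine Prod.ext (funext fun w => ?_) (funext fun w => ?_)
  · have h := (hα.1 w)
    exact absurd (h.1.trans_le (h.2.trans hN)) (lt_irrefl _)
  · have h := (hα.2 w).trans hN
    exact norm_le_zero_iff.1 h

/-- `A₀(N)` is finite (a bounded piece of the lattice `𝓞_K ⊂ ℝ^{r₁} × ℂ^{r₂}`).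
[cite: CastilloEtAl2015, §2.1 (A₀(N))] -/
theorem finite_box₀ (N : ℝ) : (box₀ K N).Finite := by
  classical
  by_cases hN : 0 < N
  · have hfin : ((N • unitBox K) ∩
        (mixedEmbedding.integerLattice K : Set (mixedSpace K))).Finite := by
      rw [← span_latticeBasis]
      exact ZSpan.setFinite_inter _ (isBounded_unitBox.smul₀ N)
    have hsub : box₀ K N ⊆ (fun α : 𝓞 K => mixedEmbedding K (α : K)) ⁻¹'
        ((N • unitBox K) ∩ (mixedEmbedding.integerLattice K : Set (mixedSpace K))) :=
      fun α hα => ⟨(mem_box₀ hN).1 hα, ⟨α, rfl⟩⟩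
    refine (hfin.preimage fun a _ b _ hab => ?_).subset hsub
    exact RingOfIntegers.ext ((mixedEmbedding K).injective hab)
  · exact (Set.finite_singleton (0 : 𝓞 K)).subset (box₀_subset_zero (le_of_not_gt hN))

/-- `A(N) ⊆ A₀(2N)`, so `A(N)` is finite. [cite: CastilloEtAl2015, §2.1 (A(N))] -/
theorem finite_box (N : ℝ) : (box K N).Finite :=
  (finite_box₀ (2 * N)).subset fun _ h => h.1

omit [NumberField K] in
/-- `A₀` is increasing in `N`. [folklore] -/
theorem box₀_mono {N N' : ℝ} (h : N ≤ N') : box₀ K N ⊆ box₀ K N' :=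
  fun _ hα => ⟨fun w => ⟨(hα.1 w).1, (hα.1 w).2.trans h⟩, fun w => (hα.2 w).trans h⟩

omit [NumberField K] in
/-- Boxes at scales `N` and `N' ≥ 2N` are disjoint (`A(N) ⊆ A₀(2N) ⊆ A₀(N')` is removed from
`A(N')`). [folklore] -/
theorem disjoint_box {N N' : ℝ} (h : 2 * N ≤ N') : Disjoint (box K N) (box K N') :=
  Set.disjoint_left.2 fun _ hα hα' => hα'.2 (box₀_mono h hα.1)

omit [NumberField K] in
/-- **"If `S > 0` for all large `N`, then there are infinitely many translates"** (proof of
Corollary 2.6): if every box `A(N)`, `N ≥ N₀`, contains an `α` with property `Q`, then infinitely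
many `α` have `Q` — the boxes `A(2^j N₀)` are pairwise disjoint.
[cite: CastilloEtAl2015, proof of Corollary 2.6] -/
theorem infinite_of_forall_exists_mem_box {N₀ : ℝ} (hN₀ : 0 < N₀) {Q : 𝓞 K → Prop}
    (h : ∀ N : ℝ, N₀ ≤ N → ∃ α ∈ box K N, Q α) : {α : 𝓞 K | Q α}.Infinite := by
  choose f hf hQ using fun j : ℕ => h (2 ^ j * N₀) (le_mul_of_one_le_left hN₀.le (one_le_pow₀
    (by norm_num)))
  have hinj : Function.Injective f := by
    intro i j hij
    by_contra hne
    wlog hlt : i < j generalizing i j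
    · exact this hij.symm (Ne.symm hne) (lt_of_le_of_ne (le_of_not_gt hlt) (Ne.symm hne))
    have hdisj : Disjoint (box K (2 ^ i * N₀)) (box K (2 ^ j * N₀)) := by
      refine disjoint_box ?_
      calc 2 * (2 ^ i * N₀) = 2 ^ (i + 1) * N₀ := by ring
        _ ≤ 2 ^ j * N₀ := by gcongr <;> norm_num; omega
    exact Set.disjoint_left.1 hdisj (hf i) (hij ▸ hf j)
  exact Set.infinite_of_injective_forall_mem hinj hQ

/-! ### The positivity step of the sieve -/

/-- **"Because each summand is non-negative, if `S₂ > ρ S₁` then at least one `α ∈ A(N)` has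
more than `ρ` of the values `α + h₁, …, α + h_k` prime"** (§2.2): for nonnegative weights
`w(α)² `, `0 < ∑_α w(α)² (#{h ∈ H : P(α + h)} − ρ)` forces `#{h ∈ H : P(α + h)} > ρ` for some
`α ∈ A`. [cite: CastilloEtAl2015, §2.2 (S₂ > ρS₁ ⇒ more than ρ primes)] -/
theorem exists_lt_card_of_sum_pos {R : Type*} [AddCommMonoid R] (A H : Finset R) (w : R → ℝ)
    (P : R → Prop) [DecidablePred P] (ρ : ℝ)
    (hpos : 0 < ∑ α ∈ A, w α ^ 2 * (((H.filter fun h => P (α + h)).card : ℝ) - ρ)) :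
    ∃ α ∈ A, ρ < ((H.filter fun h => P (α + h)).card : ℝ) := by
  by_contra hcon
  push Not at hcon
  have : ∑ α ∈ A, w α ^ 2 * (((H.filter fun h => P (α + h)).card : ℝ) - ρ) ≤ 0 :=
    Finset.sum_nonpos fun α hα => mul_nonpos_of_nonneg_of_nonpos (sq_nonneg _)
      (sub_nonpos.2 (hcon α hα))
  exact absurd hpos this.not_gt


/-! ### The logical skeleton of Corollary 2.6 -/

omit [NumberField K] in
/-- **Skeleton of the proof of Corollary 2.6**: if for every large `N` there are a finite
`A ⊆ A(N)` (in the paper: the `α ∈ A(N)` with `α ≡ v₀ (mod 𝔴)`) and real weights `wt(α)` (in the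
paper: `∑_{𝔡ᵢ ∣ α+hᵢ} λ_{𝔡₁,…,𝔡_k}`) with `S₂ > ρ S₁`, i.e.
`ρ ∑_A wt(α)² < ∑_A #{h ∈ H : P(α + h)} · wt(α)²`, then infinitely many `α` have more than `ρ` of
the `α + h`, `h ∈ H`, satisfying `P` ("Consequently, if `S > 0` for all large `N`, then there are
infinitely many translates of `(h₁, …, h_k)` containing more than `ρ` primes"). What Proposition 2.1
must supply is the existence of such weights with `ρ = ⌈θ M_k/2⌉ − 1`.
[cite: CastilloEtAl2015, proof of Corollary 2.6 (S > 0 for all large N)] -/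
theorem infinite_setOf_lt_card_of_sieve (H : Finset (𝓞 K)) (P : 𝓞 K → Prop) [DecidablePred P]
    (ρ : ℝ) {N₀ : ℝ} (hN₀ : 0 < N₀)
    (h : ∀ N : ℝ, N₀ ≤ N → ∃ (A : Finset (𝓞 K)) (wt : 𝓞 K → ℝ), (↑A : Set (𝓞 K)) ⊆ box K N ∧
      ρ * ∑ α ∈ A, wt α ^ 2 < ∑ α ∈ A, ((H.filter fun h => P (α + h)).card : ℝ) * wt α ^ 2) :
    {α : 𝓞 K | ρ < ((H.filter fun h => P (α + h)).card : ℝ)}.Infinite := by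
  refine infinite_of_forall_exists_mem_box hN₀ fun N hN => ?_
  obtain ⟨A, wt, hA, hlt⟩ := h N hN
  have hpos : 0 < ∑ α ∈ A, wt α ^ 2 * (((H.filter fun h => P (α + h)).card : ℝ) - ρ) := by
    rw [Finset.mul_sum, ← sub_pos, ← Finset.sum_sub_distrib] at hlt
    refine hlt.trans_eq (Finset.sum_congr rfl fun α _ => ?_)
    ring
  obtain ⟨α, hα, hρ⟩ := exists_lt_card_of_sum_pos A H wt P ρ hpos
  exact ⟨α, hA hα, hρ⟩

omit [NumberField K] in
/-- In particular with `ρ = m − 1` (`m ∈ ℕ`): infinitely many `α` with **at least `m`** of the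
`α + h` satisfying `P`; for `m = 2` and `P = Prime` this is the conclusion of the fact
`castilloEtAl2015_thm_1_1_totallyReal` (two distinct `h₁, h₂`).
[cite: CastilloEtAl2015, Corollary 2.6 (at least r_k of the α + hᵢ are prime)] -/
theorem infinite_setOf_le_card_of_sieve (H : Finset (𝓞 K)) (P : 𝓞 K → Prop) [DecidablePred P]
    (m : ℕ) {N₀ : ℝ} (hN₀ : 0 < N₀)
    (h : ∀ N : ℝ, N₀ ≤ N → ∃ (A : Finset (𝓞 K)) (wt : 𝓞 K → ℝ), (↑A : Set (𝓞 K)) ⊆ box K N ∧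
      ((m : ℝ) - 1) * ∑ α ∈ A, wt α ^ 2 <
        ∑ α ∈ A, ((H.filter fun h => P (α + h)).card : ℝ) * wt α ^ 2) :
    {α : 𝓞 K | m ≤ (H.filter fun h => P (α + h)).card}.Infinite := by
  refine (infinite_setOf_lt_card_of_sieve H P ((m : ℝ) - 1) hN₀ h).mono fun α hα => ?_
  have hα' : ((m : ℝ) - 1) < ((H.filter fun h => P (α + h)).card : ℝ) := hα
  have : (m : ℝ) < ((H.filter fun h => P (α + h)).card : ℝ) + 1 := by linarith
  exact_mod_cast Nat.lt_add_one_iff.1 (by exact_mod_cast this)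

/-- The conclusion format of the fact: `2 ≤ #{h ∈ H : Prime (α + h)}` gives two distinct
`h₁, h₂ ∈ H` with `α + h₁`, `α + h₂` prime. [cite: CastilloEtAl2015, Theorem 1.1 (m = 2)] -/
theorem exists_two_primes_of_two_le_card {R : Type*} [CommMonoidWithZero R] [Add R] (H : Finset R)
    (α : R) [DecidablePred fun h : R => Prime (α + h)]
    (h2 : 2 ≤ (H.filter fun h => Prime (α + h)).card) :
    ∃ h₁ ∈ H, ∃ h₂ ∈ H, h₁ ≠ h₂ ∧ Prime (α + h₁) ∧ Prime (α + h₂) := by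
  obtain ⟨h₁, h₁m, h₂, h₂m, hne⟩ := Finset.one_lt_card.1 h2
  rw [Finset.mem_filter] at h₁m h₂m
  exact ⟨h₁, h₁m.1, h₂, h₂m.1, hne, h₁m.2, h₂m.2⟩

end Boxes

/-! ## §2.3: `Δ = 1` (the constants of Corollary 2.6 for `A = 𝓞_K`) -/

section Delta

open Filter Topology NumberField NumberField.InfinitePlace NumberField.Units


/-- **`Δ = 1`, abstract form** (end of the proof of Corollary 2.6, "Referring back to the definition
of `Δ`, we find after some algebra that indeed `Δ = 1`"): if `|A(N)|/(2N)^d → a > 0`,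
`|P(N)| log((2N)^d)/(2N)^d → p` and `c_A · p = a`, then
`Δ = c_A · lim |P(N)| log|A(N)| / |A(N)| = 1`. [cite: CastilloEtAl2015, proof of Corollary 2.6 (Δ = 1)] -/
theorem tendsto_delta_of_asymptotics {d : ℕ} (hd : d ≠ 0) {a p cA : ℝ} (ha : 0 < a)
    (hcap : cA * p = a) {cardA cardP : ℝ → ℝ}
    (hA : Tendsto (fun N : ℝ => cardA N / (2 * N) ^ d) atTop (𝓝 a))
    (hP : Tendsto (fun N : ℝ => cardP N * Real.log ((2 * N) ^ d) / (2 * N) ^ d) atTop (𝓝 p)) :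
    Tendsto (fun N : ℝ => cA * (cardP N * Real.log (cardA N) / cardA N)) atTop (𝓝 1) := by
  -- `L(N) = log((2N)^d) → ∞`
  have hL : Tendsto (fun N : ℝ => Real.log ((2 * N) ^ d)) atTop atTop := by
    have h2N : Tendsto (fun N : ℝ => (2 * N) ^ d) atTop atTop :=
      (tendsto_pow_atTop hd).comp (tendsto_id.const_mul_atTop (by norm_num : (0 : ℝ) < 2))
    exact Real.tendsto_log_atTop.comp h2N
  -- eventually everything is positive
  have hpos2N : ∀ᶠ N : ℝ in atTop, 0 < (2 * N) ^ d := by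
    filter_upwards [eventually_gt_atTop 0] with N hN using by positivity
  have hratio_pos : ∀ᶠ N : ℝ in atTop, 0 < cardA N / (2 * N) ^ d :=
    hA.eventually (eventually_gt_nhds ha)
  have hApos : ∀ᶠ N : ℝ in atTop, 0 < cardA N := by
    filter_upwards [hratio_pos, hpos2N] with N h1 h2
    have := mul_pos h1 h2
    rwa [div_mul_cancel₀ _ h2.ne'] at this
  have hLpos : ∀ᶠ N : ℝ in atTop, 0 < Real.log ((2 * N) ^ d) := hL.eventually (eventually_gt_atTop 0)
  -- `log |A(N)| / L(N) → 1`
  have hlogratio : Tendsto (fun N : ℝ => Real.log (cardA N) / Real.log ((2 * N) ^ d)) atTop (𝓝 1) := by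
    have h1 : Tendsto (fun N : ℝ => Real.log (cardA N / (2 * N) ^ d) / Real.log ((2 * N) ^ d))
        atTop (𝓝 0) :=
      ((Real.continuousAt_log ha.ne').tendsto.comp hA).div_atTop hL
    have h2 : Tendsto (fun N : ℝ => Real.log (cardA N / (2 * N) ^ d) / Real.log ((2 * N) ^ d) + 1)
        atTop (𝓝 1) := by simpa using h1.add_const 1
    refine h2.congr' ?_
    filter_upwards [hApos, hpos2N, hLpos] with N h1 h2 h3
    rw [Real.log_div h1.ne' h2.ne', sub_div, div_self h3.ne']
    ring
  -- `(2N)^d / |A(N)| → 1/a`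
  have hinv : Tendsto (fun N : ℝ => (2 * N) ^ d / cardA N) atTop (𝓝 a⁻¹) := by
    have := hA.inv₀ ha.ne'
    refine this.congr' ?_
    filter_upwards [hApos, hpos2N] with N h1 h2
    rw [inv_div]
  -- assemble
  have key : Tendsto (fun N : ℝ => cA * ((cardP N * Real.log ((2 * N) ^ d) / (2 * N) ^ d) *
      (Real.log (cardA N) / Real.log ((2 * N) ^ d)) * ((2 * N) ^ d / cardA N))) atTop
      (𝓝 (cA * (p * 1 * a⁻¹))) :=
    ((hP.mul hlogratio).mul hinv).const_mul cA
  have hlim : cA * (p * 1 * a⁻¹) = 1 := by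
    rw [mul_one, ← mul_assoc, hcap, mul_inv_cancel₀ ha.ne']
  rw [hlim] at key
  refine key.congr' ?_
  filter_upwards [hApos, hpos2N, hLpos] with N h1 h2 h3
  field_simp

/-- **`Δ = 1` for totally real `K`** with the constants of §2.3: if
`|A(N)|/(2N)^d → (1 − 2^{−d})/√|D_K|` ("`|A(N)| ∼ (2π)^{r₂}(2N)^d(1 − 1/2^d)/√|D|`", `r₂ = 0`) and
`|P(N)| log((2N)^d)/(2N)^d → w_K (1 − 2^{−d})/(2^{r₁} h_K Reg_K)` (Mitsui's theorem with Hinz's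
evaluation of the integral, "`|P(N)| ∼ (w_K/(2^{r₁} h_K Reg_K))(1 − 1/2^d)(2N)^d/log((2N)^d)`"),
then with `c_A = Res_{s=1} ζ_K = 2^{r₁}(2π)^{r₂} h_K Reg_K/(w_K √|D_K|)` (Dedekind's class number formula,
Mathlib's `dedekindZeta_residue`), `c_A · |P(N)| log|A(N)|/|A(N)| → 1`. The two hypotheses are the
deep inputs (lattice-point count; Mitsui 1956 + Hinz 1981) and are NOT proved here.
[cite: CastilloEtAl2015, proof of Corollary 2.6 (Δ = 1 for A = 𝓞_K)] -/
theorem tendsto_delta_totallyReal (K : Type*) [Field K] [NumberField K] [IsTotallyReal K]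
    {cardA cardP : ℝ → ℝ}
    (hA : Tendsto (fun N : ℝ => cardA N / (2 * N) ^ Module.finrank ℚ K) atTop
      (𝓝 ((1 - 2⁻¹ ^ Module.finrank ℚ K) / √|(discr K : ℝ)|)))
    (hP : Tendsto (fun N : ℝ => cardP N * Real.log ((2 * N) ^ Module.finrank ℚ K) /
        (2 * N) ^ Module.finrank ℚ K) atTop
      (𝓝 (torsionOrder K / (2 ^ Module.finrank ℚ K * classNumber K * regulator K) *
        (1 - 2⁻¹ ^ Module.finrank ℚ K)))) :
    Tendsto (fun N : ℝ => dedekindZeta_residue K * (cardP N * Real.log (cardA N) / cardA N))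
      atTop (𝓝 1) := by
  have hd : Module.finrank ℚ K ≠ 0 := Module.finrank_pos.ne'
  have hD : 0 < √|(discr K : ℝ)| := Real.sqrt_pos.2 (abs_pos.2 (Int.cast_ne_zero.2 (discr_ne_zero K)))
  have h2d : (0 : ℝ) < 1 - 2⁻¹ ^ Module.finrank ℚ K := by
    rw [sub_pos]
    exact pow_lt_one₀ (by norm_num) (by norm_num) hd
  have ha : 0 < (1 - 2⁻¹ ^ Module.finrank ℚ K) / √|(discr K : ℝ)| := div_pos h2d hD
  refine tendsto_delta_of_asymptotics hd ha ?_ hA hP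
  rw [dedekindZeta_residue_def, IsTotallyReal.nrComplexPlaces_eq_zero, pow_zero, mul_one,
    ← IsTotallyReal.finrank]
  have hR := regulator_pos K
  have hh : (0 : ℝ) < classNumber K := Nat.cast_pos.2 (classNumber_pos K)
  have hw : (0 : ℝ) < torsionOrder K := Nat.cast_pos.2 (torsionOrder_pos K)
  field_simp


end Delta

/-! ## §2.1 uniformly in the modulus: `#(A₀(N) ∩ (α₀ + 𝔮)) = N^d/(N𝔮√|D_K|) + O(1 + (N^d/N𝔮)^{1−1/d})`

The residue-class count of `abs_card_box₀_coset_sub_le` has an error term depending on `𝔮`; the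
sieve of §2.2 needs it uniform in `𝔮` with a power saving, as printed in §2.1:
`|∂A(N, 𝔮)| ≪ 1 + (|A(N)|/|𝔮|)^{1−1/d}`. The standard reduction: a Minkowski-short `x₁ ∈ 𝔮`
(`exists_ne_zero_mem_ideal_forall_lt`), the splitting of `α₀ + 𝔮` into the `|N x₁|/N𝔮 ≤ c₁^d`
cosets of `x₁𝓞_K` (`card_box₀_coset_eq_sum`, `card_map_mk_mul_absNorm`), each of which is the
fixed lattice `ι(𝓞_K) ⊂ ℝ^{r₁}` in a coordinate box of sides `N/|σ_w x₁| ≤ c₁^{d−1}(N^d/N𝔮)^{1/d}`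
(`card_fibre_eq`, `fibreBox`), counted uniformly by
`Literature.Algebra.EuclideanLattices.abs_card_inter_coordBox_sub_le`; the main constant
`vol(P) = √|D_K|` is identified through the fixed-`𝔮` count. Result:
`abs_card_box₀_coset_sub_le_uniform`. -/

section UniformCount

open NumberField NumberField.InfinitePlace NumberField.mixedEmbedding Set MeasureTheory Module
open scoped nonZeroDivisors NNReal ENNReal Classical

variable (K : Type*) [Field K] [NumberField K]


/-- **A short vector in every ideal** (Minkowski's convex body theorem in the box
`{|x_w| < c}`: the volume `2^{r₁} π^{r₂} c^d` exceeds `2^d · N𝔮 · covol(𝓞_K)` for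
`c^d = A N𝔮 + 1`): there is `c₁ = c₁(K) > 0` such that every nonzero ideal `𝔮` of `𝓞_K` contains
`x ≠ 0` with `|σ(x)| < c₁ N𝔮^{1/d}` at every infinite place. This is the element by which §2.1
reduces the count in `𝔮` to finitely many counts in the fixed lattice `𝓞_K`. [folklore] -/
theorem exists_ne_zero_mem_ideal_forall_lt :
    ∃ c₁ : ℝ, 0 < c₁ ∧ ∀ 𝔮 : (Ideal (𝓞 K))⁰, ∃ x ∈ (𝔮 : Ideal (𝓞 K)), x ≠ 0 ∧
      ∀ w : InfinitePlace K, w (x : K) <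
        c₁ * (Ideal.absNorm (𝔮 : Ideal (𝓞 K)) : ℝ) ^ (1 / (finrank ℚ K : ℝ)) := by
  set d : ℕ := finrank ℚ K with hd
  have hd0 : 0 < d := finrank_pos
  have hdR : (0 : ℝ) < d := by exact_mod_cast hd0
  have hVtop : volume (ZSpan.fundamentalDomain (latticeBasis K)) ≠ ⊤ :=
    ((ZSpan.fundamentalDomain_isBounded _).measure_lt_top).ne
  set V : ℝ≥0 := (volume (ZSpan.fundamentalDomain (latticeBasis K))).toNNReal with hVdef
  have hV : volume (ZSpan.fundamentalDomain (latticeBasis K)) = V := (ENNReal.coe_toNNReal hVtop).symm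
  set A : ℝ≥0 := V * 2 ^ d / convexBodyLTFactor K with hA
  refine ⟨((A : ℝ) + 1) ^ (1 / (d : ℝ)), by positivity, fun 𝔮 => ?_⟩
  set n : ℕ := Ideal.absNorm (𝔮 : Ideal (𝓞 K)) with hn
  have hn1 : 1 ≤ n := Nat.one_le_iff_ne_zero.2 (Ideal.absNorm_ne_zero_of_nonZeroDivisors 𝔮)
  set c : ℝ≥0 := ((n : ℝ≥0) * A + 1) ^ (1 / (d : ℝ)) with hc
  have hcd : c ^ d = (n : ℝ≥0) * A + 1 := by
    rw [hc, ← NNReal.rpow_natCast, ← NNReal.rpow_mul, one_div_mul_cancel hdR.ne', NNReal.rpow_one]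
  have key : minkowskiBound K (FractionalIdeal.mk0 K 𝔮) < volume (convexBodyLT K fun _ => c) := by
    rw [convexBodyLT_volume, Finset.prod_pow_eq_pow_sum, sum_mult_eq, minkowskiBound,
      volume_fundamentalDomain_fractionalIdealLatticeBasis, hV, mixedEmbedding.finrank,
      FractionalIdeal.coe_mk0, FractionalIdeal.coeIdeal_absNorm, Rat.cast_natCast,
      ENNReal.ofReal_natCast]
    have h1 : ((n : ℝ≥0∞)) * (V : ℝ≥0∞) * 2 ^ d = ((n * V * 2 ^ d : ℝ≥0) : ℝ≥0∞) := by push_cast; ring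
    rw [← hd, h1, ← ENNReal.coe_mul, ENNReal.coe_lt_coe, hcd, mul_add, mul_one]
    have hfac : convexBodyLTFactor K * ((n : ℝ≥0) * A) = n * V * 2 ^ d := by
      rw [hA, mul_comm, mul_assoc, div_mul_cancel₀ _ (convexBodyLTFactor_ne_zero K), mul_assoc]
    rw [hfac]
    exact lt_add_of_pos_right _ (pos_iff_ne_zero.2 (convexBodyLTFactor_ne_zero K))
  obtain ⟨a, ha, ha0, hlt⟩ := exists_ne_zero_mem_ideal_lt K (FractionalIdeal.mk0 K 𝔮) key
  rw [FractionalIdeal.coe_mk0, FractionalIdeal.mem_coeIdeal] at ha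
  obtain ⟨x, hx, rfl⟩ := ha
  refine ⟨x, hx, fun h => ha0 (by simp [h]), fun w => ?_⟩
  have hcle : (c : ℝ) ≤ ((A : ℝ) + 1) ^ (1 / (d : ℝ)) * (n : ℝ) ^ (1 / (d : ℝ)) := by
    rw [hc, NNReal.coe_rpow, ← Real.mul_rpow (by positivity) (by positivity)]
    push_cast
    refine Real.rpow_le_rpow (by positivity) ?_ (by positivity)
    have : (1 : ℝ) ≤ n := by exact_mod_cast hn1
    nlinarith [A.coe_nonneg]
  exact (hlt w).trans_le hcle

/-- `N𝔮 ≤ |N_{K/ℚ}(x)|` for a nonzero `x ∈ 𝔮` (`𝔮 ∣ (x)`). [folklore] -/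
theorem absNorm_le_abs_norm_of_mem {𝔮 : Ideal (𝓞 K)} {x : 𝓞 K} (hx : x ∈ 𝔮) (hx0 : x ≠ 0) :
    (Ideal.absNorm 𝔮 : ℝ) ≤ |(Algebra.norm ℚ (x : K) : ℝ)| := by
  have hdvd : Ideal.absNorm 𝔮 ∣ Ideal.absNorm (Ideal.span {x}) :=
    Ideal.absNorm_dvd_absNorm_of_le ((Ideal.span_singleton_le_iff_mem _).2 hx)
  have hne : Ideal.absNorm (Ideal.span {x}) ≠ 0 := by
    rw [Ne, Ideal.absNorm_eq_zero_iff, Ideal.span_singleton_eq_bot]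
    exact hx0
  have hle := Nat.le_of_dvd (Nat.pos_of_ne_zero hne) hdvd
  rw [Ideal.absNorm_span_singleton] at hle
  have h1 : ((Ideal.absNorm 𝔮 : ℕ) : ℝ) ≤ ((Algebra.norm ℤ x).natAbs : ℝ) := by exact_mod_cast hle
  refine h1.trans (le_of_eq ?_)
  rw [Nat.cast_natAbs, Int.cast_abs, ← Algebra.coe_norm_int]
  push_cast
  rfl

/-- If all conjugates of a nonzero `x ∈ 𝔮` are `< C₀` then each (real) conjugate is
`≥ N𝔮/C₀^{d−1}`, for totally real `K` (`∏_w |σ_w x| = |N x| ≥ N𝔮`). [folklore] -/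
theorem le_apply_of_forall_lt [IsTotallyReal K] {𝔮 : Ideal (𝓞 K)} {x : 𝓞 K} (hx : x ∈ 𝔮)
    (hx0 : x ≠ 0) {C₀ : ℝ} (hlt : ∀ w : InfinitePlace K, w (x : K) < C₀) (w₀ : InfinitePlace K) :
    (Ideal.absNorm 𝔮 : ℝ) / C₀ ^ (finrank ℚ K - 1) ≤ w₀ (x : K) := by
  have hC₀ : 0 < C₀ := (apply_nonneg w₀ _).trans_lt (hlt w₀)
  have hprod : ∏ w : InfinitePlace K, w (x : K) = |(Algebra.norm ℚ (x : K) : ℝ)| := by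
    have h := prod_eq_abs_norm (x : K)
    simp only [IsTotallyReal.mult_eq, pow_one] at h
    rw [h, Rat.cast_abs]
  have hcard : (Finset.univ.erase w₀).card = finrank ℚ K - 1 := by
    rw [Finset.card_erase_of_mem (Finset.mem_univ _), Finset.card_univ,
      card_eq_nrRealPlaces_add_nrComplexPlaces, IsTotallyReal.nrComplexPlaces_eq_zero, add_zero,
      ← IsTotallyReal.finrank]
  have hrest : ∏ w ∈ Finset.univ.erase w₀, w (x : K) ≤ C₀ ^ (finrank ℚ K - 1) := by
    rw [← hcard, ← Finset.prod_const]
    exact Finset.prod_le_prod (fun w _ => apply_nonneg _ _) fun w _ => (hlt w).le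
  have hrest0 : 0 ≤ ∏ w ∈ Finset.univ.erase w₀, w (x : K) :=
    Finset.prod_nonneg fun w _ => apply_nonneg _ _
  have hsplit : w₀ (x : K) * ∏ w ∈ Finset.univ.erase w₀, w (x : K) = |(Algebra.norm ℚ (x : K) : ℝ)| := by
    rw [Finset.mul_prod_erase Finset.univ (fun w : InfinitePlace K => w (x : K)) (Finset.mem_univ w₀),
      hprod]
  have hN := absNorm_le_abs_norm_of_mem K hx hx0
  rw [div_le_iff₀ (by positivity)]
  calc (Ideal.absNorm 𝔮 : ℝ) ≤ |(Algebra.norm ℚ (x : K) : ℝ)| := hN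
    _ = w₀ (x : K) * ∏ w ∈ Finset.univ.erase w₀, w (x : K) := hsplit.symm
    _ ≤ w₀ (x : K) * C₀ ^ (finrank ℚ K - 1) :=
        mul_le_mul_of_nonneg_left hrest (apply_nonneg _ _)

/-! ### The real Minkowski space of a totally real field -/

section RealSpace

variable [IsTotallyReal K]

/-- For totally real `K` the complex factor of the mixed space is a one-point type. [folklore] -/
instance uniqueComplexPart : Unique ({w : InfinitePlace K // w.IsComplex} → ℂ) :=
  haveI := isEmpty_isComplex (K := K)
  Pi.uniqueOfIsEmpty _

/-- Projection of the mixed space `ℝ^{r₁} × ℂ^{0}` of a totally real field onto `ℝ^{r₁}`, a linear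
isomorphism. [folklore] -/
noncomputable def fstEquiv : mixedSpace K ≃ₗ[ℝ] ({w : InfinitePlace K // w.IsReal} → ℝ) :=
  LinearEquiv.prodUnique

omit [NumberField K] in
/-- `fstEquiv` is the first projection. [folklore] -/
@[simp] theorem fstEquiv_apply (x : mixedSpace K) : fstEquiv K x = x.1 := rfl

/-- The image of Mathlib's lattice basis of `𝓞_K` in `ℝ^{r₁}`: an `ℝ`-basis of `ℝ^{r₁}` spanning
the real Minkowski lattice `ι(𝓞_K)` over `ℤ`. [folklore] -/
noncomputable def realLatticeBasis : Basis (Free.ChooseBasisIndex ℤ (𝓞 K)) ℝ ({w : InfinitePlace K // w.IsReal} → ℝ) :=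
  (latticeBasis K).map (fstEquiv K)

/-- The real Minkowski embedding of `𝓞_K` (totally real `K`): `α ↦ (σ_w(α))_w`. [folklore] -/
noncomputable def realEmb (α : 𝓞 K) : {w : InfinitePlace K // w.IsReal} → ℝ := (mixedEmbedding K (α : K)).1

omit [NumberField K] [IsTotallyReal K] in
/-- `ι` is additive. [folklore] -/
theorem realEmb_add (α β : 𝓞 K) : realEmb K (α + β) = realEmb K α + realEmb K β := by
  simp [realEmb, map_add]

omit [NumberField K] [IsTotallyReal K] in
/-- `ι` is multiplicative (coordinatewise). [folklore] -/
theorem realEmb_mul (α β : 𝓞 K) : realEmb K (α * β) = realEmb K α * realEmb K β := by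
  simp [realEmb, map_mul]

/-- The real Minkowski embedding is injective. [folklore] -/
theorem realEmb_injective : Function.Injective (realEmb K) := by
  intro a b h
  have h' : mixedEmbedding K (a : K) = mixedEmbedding K (b : K) :=
    Prod.ext h (Subsingleton.elim _ _)
  exact RingOfIntegers.ext ((mixedEmbedding K).injective h')

/-- `ι(𝓞_K) = span_ℤ (realLatticeBasis)`. [folklore] -/
theorem mem_span_realLatticeBasis {y : {w : InfinitePlace K // w.IsReal} → ℝ} :
    y ∈ Submodule.span ℤ (Set.range (realLatticeBasis K)) ↔ ∃ α : 𝓞 K, realEmb K α = y := by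
  have hrange : Set.range (realLatticeBasis K) =
      ((fstEquiv K).toLinearMap.restrictScalars ℤ) '' Set.range (latticeBasis K) := by
    rw [← Set.range_comp]; rfl
  rw [hrange, Submodule.span_image, Submodule.mem_map]
  constructor
  · rintro ⟨z, hz, rfl⟩
    rw [mem_span_latticeBasis] at hz
    obtain ⟨α, rfl⟩ := hz
    exact ⟨α, rfl⟩
  · rintro ⟨α, rfl⟩
    refine ⟨mixedEmbedding K (α : K), (mem_span_latticeBasis K).2 ⟨α, rfl⟩, rfl⟩

/-! ### The fibres of the count: a coset of a principal lattice in the box is a coordinate box -/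

/-- The coordinate box in `ℝ^{r₁}` describing `{γ : β + x₁γ ∈ A₀(N)}`: `0 < t_w + s_w y_w ≤ N`
with `t = ι(β)`, `s = ι(x₁)`. [cite: CastilloEtAl2015, §2.1 (translates of the fundamental parallelogram)] -/
def fibreBox (t s : {w : InfinitePlace K // w.IsReal} → ℝ) (N : ℝ) :
    Set ({w : InfinitePlace K // w.IsReal} → ℝ) :=
  {y | ∀ w, t w + s w * y w ∈ Ioc 0 N}

/-- Lower corner of `fibreBox`. [folklore] -/
noncomputable def fibreLo (t s : {w : InfinitePlace K // w.IsReal} → ℝ) (N : ℝ)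
    (w : {w : InfinitePlace K // w.IsReal}) : ℝ :=
  if 0 < s w then (0 - t w) / s w else (N - t w) / s w

/-- Upper corner of `fibreBox`. [folklore] -/
noncomputable def fibreHi (t s : {w : InfinitePlace K // w.IsReal} → ℝ) (N : ℝ)
    (w : {w : InfinitePlace K // w.IsReal}) : ℝ :=
  if 0 < s w then (N - t w) / s w else (0 - t w) / s w

omit [NumberField K] [IsTotallyReal K] in
/-- The sides of `fibreBox` are `N/|s_w|`. [folklore] -/
theorem fibreHi_sub_fibreLo {t s : {w : InfinitePlace K // w.IsReal} → ℝ} {N : ℝ}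
    (hs : ∀ w, s w ≠ 0) (w : {w : InfinitePlace K // w.IsReal}) :
    fibreHi K t s N w - fibreLo K t s N w = N / |s w| := by
  simp only [fibreHi, fibreLo]
  split_ifs with h
  · rw [abs_of_pos h]; field_simp; ring
  · have h' : s w < 0 := lt_of_le_of_ne (not_lt.1 h) (hs w)
    rw [abs_of_neg h']; field_simp; ring

omit [NumberField K] [IsTotallyReal K] in
/-- The open coordinate box lies in `fibreBox`. [folklore] -/
theorem pi_Ioo_subset_fibreBox {t s : {w : InfinitePlace K // w.IsReal} → ℝ} {N : ℝ}
    (hs : ∀ w, s w ≠ 0) :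
    (Set.univ.pi fun w => Ioo (fibreLo K t s N w) (fibreHi K t s N w)) ⊆ fibreBox K t s N := by
  intro y hy w
  have h := Set.mem_univ_pi.1 hy w
  simp only [fibreLo, fibreHi, Set.mem_Ioo] at h
  split_ifs at h with hsw
  · rw [div_lt_iff₀ hsw, lt_div_iff₀ hsw] at h
    constructor <;> nlinarith [h.1, h.2]
  · have h' : s w < 0 := lt_of_le_of_ne (not_lt.1 hsw) (hs w)
    rw [div_lt_iff_of_neg h', lt_div_iff_of_neg h'] at h
    constructor <;> nlinarith [h.1, h.2]

omit [NumberField K] [IsTotallyReal K] in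
/-- `fibreBox` lies in the closed coordinate box. [folklore] -/
theorem fibreBox_subset_pi_Icc {t s : {w : InfinitePlace K // w.IsReal} → ℝ} {N : ℝ}
    (hs : ∀ w, s w ≠ 0) :
    fibreBox K t s N ⊆ Set.univ.pi fun w => Icc (fibreLo K t s N w) (fibreHi K t s N w) := by
  intro y hy
  refine Set.mem_univ_pi.2 fun w => ?_
  have h := hy w
  simp only [fibreLo, fibreHi, Set.mem_Icc, Set.mem_Ioc] at h ⊢
  split_ifs with hsw
  · rw [div_le_iff₀ hsw, le_div_iff₀ hsw]
    constructor <;> nlinarith [h.1, h.2]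
  · have h' : s w < 0 := lt_of_le_of_ne (not_lt.1 hsw) (hs w)
    rw [div_le_iff_of_neg h', le_div_iff_of_neg h']
    constructor <;> nlinarith [h.1, h.2]

omit [NumberField K] [IsTotallyReal K] in
/-- `lo ≤ hi` for `N ≥ 0`. [folklore] -/
theorem fibreLo_le_fibreHi {t s : {w : InfinitePlace K // w.IsReal} → ℝ} {N : ℝ} (hN : 0 ≤ N)
    (hs : ∀ w, s w ≠ 0) (w : {w : InfinitePlace K // w.IsReal}) :
    fibreLo K t s N w ≤ fibreHi K t s N w := by
  have := fibreHi_sub_fibreLo K hs w (t := t) (N := N)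
  have h0 : 0 ≤ N / |s w| := div_nonneg hN (abs_nonneg _)
  linarith

/-- **The fibre bijection**: `{γ ∈ 𝓞_K : β + x₁γ ∈ A₀(N)}` corresponds under the real Minkowski
embedding to the points of the lattice `ι(𝓞_K)` in `fibreBox ι(β) ι(x₁) N`.
[cite: CastilloEtAl2015, §2.1 (the constraints on A(N) correspond to a region of Minkowski space)] -/
theorem card_fibre_eq {N : ℝ} (x₁ β : 𝓞 K) :
    Nat.card {γ : 𝓞 K // β + x₁ * γ ∈ box₀ K N} =
      Nat.card ((fibreBox K (realEmb K β) (realEmb K x₁) N) ∩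
        (Submodule.span ℤ (Set.range (realLatticeBasis K)) :
          Set ({w : InfinitePlace K // w.IsReal} → ℝ)) : Set _) := by
  haveI := isEmpty_isComplex (K := K)
  have hmem : ∀ γ : 𝓞 K, β + x₁ * γ ∈ box₀ K N ↔
      realEmb K γ ∈ fibreBox K (realEmb K β) (realEmb K x₁) N := by
    intro γ
    simp only [box₀, Set.mem_setOf_eq, fibreBox, IsEmpty.forall_iff, and_true]
    refine forall_congr' fun w => ?_
    rw [show (mixedEmbedding K ((β + x₁ * γ : 𝓞 K) : K)).1 w =
      realEmb K β w + realEmb K x₁ w * realEmb K γ w by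
        simp [realEmb, map_add, map_mul]]
  let f : {γ : 𝓞 K // β + x₁ * γ ∈ box₀ K N} →
      ((fibreBox K (realEmb K β) (realEmb K x₁) N) ∩
        (Submodule.span ℤ (Set.range (realLatticeBasis K)) : Set _) : Set _) :=
    fun γ => ⟨realEmb K γ.1, (hmem _).1 γ.2, (mem_span_realLatticeBasis K).2 ⟨γ.1, rfl⟩⟩
  refine Nat.card_congr (Equiv.ofBijective f ⟨fun a b h => ?_, fun y => ?_⟩)
  · exact Subtype.ext (realEmb_injective K (congrArg Subtype.val h))
  · obtain ⟨α, hα⟩ := (mem_span_realLatticeBasis K).1 y.2.2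
    refine ⟨⟨α, (hmem α).2 (hα ▸ y.2.1)⟩, Subtype.ext hα⟩

end RealSpace

/-! ### Splitting the residue class `α₀ + 𝔮` into cosets of the principal ideal `(x₁) ⊆ 𝔮` -/

section Cosets

/-- `#(𝔮/(x₁)) · N𝔮 = |N(x₁)|` for `x₁ ∈ 𝔮`, `x₁ ≠ 0` (third isomorphism theorem and Lagrange).
[folklore] -/
theorem card_map_mk_mul_absNorm {x₁ : 𝓞 K} {𝔮 : Ideal (𝓞 K)} (hx : x₁ ∈ 𝔮) :
    Nat.card (𝔮.map (Ideal.Quotient.mk (Ideal.span {x₁}))) * Ideal.absNorm 𝔮 =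
      Ideal.absNorm (Ideal.span ({x₁} : Set (𝓞 K))) := by
  have hle : Ideal.span {x₁} ≤ 𝔮 := (Ideal.span_singleton_le_iff_mem _).2 hx
  have h1 := Submodule.card_eq_card_quotient_mul_card
    (𝔮.map (Ideal.Quotient.mk (Ideal.span {x₁})) : Submodule (𝓞 K ⧸ Ideal.span {x₁}) (𝓞 K ⧸ Ideal.span {x₁}))
  have h2 : Nat.card ((𝓞 K ⧸ Ideal.span {x₁}) ⧸ 𝔮.map (Ideal.Quotient.mk (Ideal.span {x₁}))) =
      Nat.card (𝓞 K ⧸ 𝔮) := Nat.card_congr (DoubleQuot.quotQuotEquivQuotOfLE hle).toEquiv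
  rw [Ideal.absNorm_apply, Ideal.absNorm_apply, Submodule.cardQuot_apply, Submodule.cardQuot_apply,
    ← h2]
  exact h1.symm

/-- **The fibration of the count over `𝔮/(x₁)`**: for `x₁ ∈ 𝔮 ∖ {0}` the elements of
`A₀(N) ∩ (α₀ + 𝔮)` split according to the class of `α − α₀` in `𝔮/(x₁)`; the class `b` (with a
representative `r_b ∈ 𝔮`) contributes `#{γ ∈ 𝓞_K : α₀ + r_b + x₁γ ∈ A₀(N)}`.
[cite: CastilloEtAl2015, §2.1 (translates of the fundamental parallelogram)] -/
theorem card_box₀_coset_eq_sum (N : ℝ) {𝔮 : Ideal (𝓞 K)} {x₁ : 𝓞 K} (hx₁0 : x₁ ≠ 0)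
    (hx₁ : x₁ ∈ 𝔮) (α₀ : 𝓞 K) [Fintype (𝓞 K ⧸ Ideal.span ({x₁} : Set (𝓞 K)))] :
    ∃ r : (𝓞 K ⧸ Ideal.span ({x₁} : Set (𝓞 K))) → 𝓞 K,
      Nat.card {α : 𝓞 K // α ∈ box₀ K N ∧ α - α₀ ∈ 𝔮} =
        ∑ b ∈ Finset.univ.filter (· ∈ 𝔮.map (Ideal.Quotient.mk (Ideal.span ({x₁} : Set (𝓞 K))))),
          Nat.card {γ : 𝓞 K // (α₀ + r b) + x₁ * γ ∈ box₀ K N} := by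
  set I : Ideal (𝓞 K) := Ideal.span ({x₁} : Set (𝓞 K)) with hI
  set mk := Ideal.Quotient.mk I with hmk
  -- representatives in `𝔮`
  have hrep : ∀ b : 𝓞 K ⧸ I, b ∈ 𝔮.map mk → ∃ r ∈ 𝔮, mk r = b := fun b hb =>
    (Ideal.mem_map_iff_of_surjective mk Ideal.Quotient.mk_surjective).1 hb
  choose! r hr𝔮 hrb using hrep
  refine ⟨r, ?_⟩
  -- the finite set being counted
  have hfin : {α : 𝓞 K | α ∈ box₀ K N ∧ α - α₀ ∈ 𝔮}.Finite := (finite_box₀ N).subset fun α h => h.1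
  set S := hfin.toFinset with hS
  have hcardS : Nat.card {α : 𝓞 K // α ∈ box₀ K N ∧ α - α₀ ∈ 𝔮} = S.card := by
    rw [hS, ← Set.ncard_eq_toFinset_card _ hfin, ← Nat.card_coe_set_eq]
    rfl
  rw [hcardS, Finset.card_eq_sum_card_fiberwise (f := fun α => mk (α - α₀))
    (t := Finset.univ.filter (· ∈ 𝔮.map mk)) ?_]
  · refine Finset.sum_congr (by ext b; simp) fun b hb => ?_
    have hbT : b ∈ 𝔮.map mk := (Finset.mem_filter.1 hb).2
    have hrb' : mk (r b) = b := hrb b hbT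
    have hr𝔮' : r b ∈ 𝔮 := hr𝔮 b hbT
    -- the fibre over `b` is `{α₀ + r_b + x₁γ}`
    rw [← Fintype.card_coe, ← Nat.card_eq_fintype_card]
    symm
    refine Nat.card_congr (Equiv.ofBijective
      (fun γ : {γ : 𝓞 K // (α₀ + r b) + x₁ * γ ∈ box₀ K N} =>
        (⟨α₀ + r b + x₁ * γ.1, ?_⟩ : {α // α ∈ S.filter fun α => mk (α - α₀) = b})) ⟨?_, ?_⟩)
    · rw [Finset.mem_filter, hS, Set.Finite.mem_toFinset]
      refine ⟨⟨γ.2, ?_⟩, ?_⟩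
      · have : α₀ + r b + x₁ * γ.1 - α₀ = r b + x₁ * γ.1 := by ring
        rw [this]
        exact 𝔮.add_mem hr𝔮' (𝔮.mul_mem_right _ hx₁)
      · have : α₀ + r b + x₁ * γ.1 - α₀ = r b + x₁ * γ.1 := by ring
        rw [this, map_add, map_mul, hrb']
        have h0 : mk x₁ = 0 := Ideal.Quotient.eq_zero_iff_mem.2 (Ideal.mem_span_singleton_self x₁)
        rw [h0, zero_mul, add_zero]
    · intro γ γ' h
      have h' : α₀ + r b + x₁ * γ.1 = α₀ + r b + x₁ * γ'.1 := congrArg Subtype.val h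
      exact Subtype.ext (mul_left_cancel₀ hx₁0 (add_left_cancel h'))
    · rintro ⟨α, hα⟩
      rw [Finset.mem_filter, hS, Set.Finite.mem_toFinset] at hα
      obtain ⟨⟨hαbox, -⟩, hαb⟩ := hα
      have hmem : α - α₀ - r b ∈ I := by
        rw [← Ideal.Quotient.eq, hrb']
        exact hαb
      obtain ⟨γ, hγ⟩ := Ideal.mem_span_singleton'.1 hmem
      have hα' : α = α₀ + r b + x₁ * γ := by rw [mul_comm, hγ]; ring
      refine ⟨⟨γ, hα' ▸ hαbox⟩, Subtype.ext hα'.symm⟩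
  · intro α hα
    have hα' : α ∈ {α : 𝓞 K | α ∈ box₀ K N ∧ α - α₀ ∈ 𝔮} := by
      simpa only [hS, Set.Finite.coe_toFinset] using hα
    exact Finset.mem_filter.2 ⟨Finset.mem_univ _, Ideal.mem_map_of_mem _ hα'.2⟩

end Cosets

/-! ### Assembly: the residue-class count, uniformly in the modulus -/

section Uniform

variable [IsTotallyReal K]

omit [NumberField K] [IsTotallyReal K] in
/-- `|ι(x)_w| = w(x)` at a real place. [folklore] -/
theorem abs_realEmb (x : 𝓞 K) (w : {w : InfinitePlace K // w.IsReal}) :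
    |realEmb K x w| = w.1 (x : K) := by
  rw [← Real.norm_eq_abs, realEmb, mixedEmbedding_apply_isReal, norm_embedding_of_isReal]

/-- `∏_{w real} w(x) = |N(x)|` for totally real `K`. [folklore] -/
theorem prod_isReal_apply_eq_abs_norm (x : 𝓞 K) :
    ∏ w : {w : InfinitePlace K // w.IsReal}, w.1 (x : K) = |(Algebra.norm ℚ (x : K) : ℝ)| := by
  have h := prod_eq_abs_norm (x : K)
  simp only [IsTotallyReal.mult_eq, pow_one] at h
  rw [← Rat.cast_abs, ← h]
  exact (Finset.prod_subtype (p := fun w : InfinitePlace K => w.IsReal) Finset.univ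
    (fun w => by simp [IsTotallyReal.isReal w]) fun w => w (x : K)).symm

/-- **Uniform count for one short element `x₁ ∈ 𝔮`**: if all conjugates of `x₁ ≠ 0` are `< C₀`
then for all `N > 0`, `α₀`, with `L = max 1 (N C₀^{d−1}/N𝔮)`,
`|#(A₀(N) ∩ (α₀ + 𝔮)) − κ N^d| ≤ (|N x₁|/N𝔮) · C_b · L^{d−1}`, `κ = (|N x₁|/N𝔮)/(|N x₁| vol P)` —
fibre over `𝔮/(x₁)`, count each fibre by `abs_card_inter_coordBox_sub_le` for the fixed lattice
`ι(𝓞_K)`. [cite: CastilloEtAl2015, §2.1 (|∂A(N,𝔮)| ≪ (|A(N)|/|𝔮|)^{1−1/d})] -/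
theorem abs_card_box₀_coset_sub_le_of_short {C_b : ℝ}
    (hCb : ∀ (lo hi : {w : InfinitePlace K // w.IsReal} → ℝ) (L : ℝ), 1 ≤ L → (∀ j, lo j ≤ hi j) →
      (∀ j, hi j - lo j ≤ L) → ∀ B : Set ({w : InfinitePlace K // w.IsReal} → ℝ),
        (Set.univ.pi fun j => Ioo (lo j) (hi j)) ⊆ B → B ⊆ (Set.univ.pi fun j => Icc (lo j) (hi j)) →
        |(Nat.card (B ∩ (Submodule.span ℤ (Set.range (realLatticeBasis K)) : Set _) : Set _) : ℝ) -
            (∏ j, (hi j - lo j)) / volume.real (ZSpan.fundamentalDomain (realLatticeBasis K))| ≤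
          C_b * L ^ (Fintype.card {w : InfinitePlace K // w.IsReal} - 1))
    {𝔮 : Ideal (𝓞 K)} {x₁ : 𝓞 K} (hx₁0 : x₁ ≠ 0) (hx₁ : x₁ ∈ 𝔮) {C₀ : ℝ}
    (hlt : ∀ w : InfinitePlace K, w (x₁ : K) < C₀) {N : ℝ} (hN : 0 < N) (α₀ : 𝓞 K) :
    |(Nat.card {α : 𝓞 K // α ∈ box₀ K N ∧ α - α₀ ∈ 𝔮} : ℝ) -
        ((Ideal.absNorm (Ideal.span ({x₁} : Set (𝓞 K))) : ℝ) / Ideal.absNorm 𝔮) /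
          (|(Algebra.norm ℚ (x₁ : K) : ℝ)| *
            volume.real (ZSpan.fundamentalDomain (realLatticeBasis K))) * N ^ finrank ℚ K| ≤
      ((Ideal.absNorm (Ideal.span ({x₁} : Set (𝓞 K))) : ℝ) / Ideal.absNorm 𝔮) * C_b *
        (max 1 (N * C₀ ^ (finrank ℚ K - 1) / Ideal.absNorm 𝔮)) ^ (finrank ℚ K - 1) := by
  set d : ℕ := finrank ℚ K with hd
  set n : ℝ := (Ideal.absNorm 𝔮 : ℝ) with hn
  set s := realEmb K x₁ with hsdef
  set L : ℝ := max 1 (N * C₀ ^ (d - 1) / n) with hL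
  have hC₀ : 0 < C₀ := (apply_nonneg _ _).trans_lt (hlt (Classical.arbitrary _))
  have h𝔮0 : 𝔮 ≠ ⊥ := fun h => hx₁0 (by simpa [h] using hx₁)
  have hn0 : 0 < n := by
    rw [hn]; exact_mod_cast Nat.pos_of_ne_zero (by rwa [Ne, Ideal.absNorm_eq_zero_iff])
  -- conjugates of `x₁`: `n/C₀^{d-1} ≤ |s w| < C₀`
  have hslo : ∀ w, n / C₀ ^ (d - 1) ≤ |s w| := fun w => by
    rw [hsdef, abs_realEmb]; exact le_apply_of_forall_lt K hx₁ hx₁0 hlt w.1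
  have hspos : ∀ w, 0 < |s w| := fun w => lt_of_lt_of_le (by positivity) (hslo w)
  have hs0 : ∀ w, s w ≠ 0 := fun w => abs_pos.1 (hspos w)
  have hcardR : Fintype.card {w : InfinitePlace K // w.IsReal} = d := by
    rw [hd, IsTotallyReal.finrank]
  -- sides of the fibre boxes
  have hside : ∀ (t : {w : InfinitePlace K // w.IsReal} → ℝ) (w),
      fibreHi K t s N w - fibreLo K t s N w ≤ L := by
    intro t w
    rw [fibreHi_sub_fibreLo K hs0]
    calc N / |s w| ≤ N / (n / C₀ ^ (d - 1)) := by gcongr; exact hslo w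
      _ = N * C₀ ^ (d - 1) / n := by field_simp
      _ ≤ L := le_max_right _ _
  have hL1 : 1 ≤ L := le_max_left _ _
  -- the product of the sides
  have hprod : ∀ t : {w : InfinitePlace K // w.IsReal} → ℝ,
      ∏ w, (fibreHi K t s N w - fibreLo K t s N w) = N ^ d / |(Algebra.norm ℚ (x₁ : K) : ℝ)| := by
    intro t
    simp_rw [fibreHi_sub_fibreLo K hs0, Finset.prod_div_distrib, Finset.prod_const, Finset.card_univ,
      hcardR]
    congr 1
    rw [← prod_isReal_apply_eq_abs_norm]
    exact Finset.prod_congr rfl fun w _ => by rw [hsdef, abs_realEmb]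
  -- fibration
  haveI : Fintype (𝓞 K ⧸ Ideal.span ({x₁} : Set (𝓞 K))) :=
    @Fintype.ofFinite _ (Ideal.finiteQuotientOfFreeOfNeBot _ (by simpa using hx₁0))
  obtain ⟨r, hr⟩ := card_box₀_coset_eq_sum K N hx₁0 hx₁ α₀
  set T := Finset.univ.filter
    (· ∈ 𝔮.map (Ideal.Quotient.mk (Ideal.span ({x₁} : Set (𝓞 K))))) with hT
  have hTcard : (T.card : ℝ) = (Ideal.absNorm (Ideal.span ({x₁} : Set (𝓞 K))) : ℝ) / n := by
    rw [eq_div_iff hn0.ne', hn]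
    have h := card_map_mk_mul_absNorm K hx₁ (x₁ := x₁)
    have hT' : T.card = Nat.card (𝔮.map (Ideal.Quotient.mk (Ideal.span ({x₁} : Set (𝓞 K))))) := by
      rw [hT, Nat.card_eq_fintype_card, ← Fintype.card_subtype]
    rw [hT']
    exact_mod_cast h
  rw [hr]
  push_cast
  -- termwise bound
  have hterm : ∀ b ∈ T, |(Nat.card {γ : 𝓞 K // α₀ + r b + x₁ * γ ∈ box₀ K N} : ℝ) -
      (N ^ d / |(Algebra.norm ℚ (x₁ : K) : ℝ)|) /
        volume.real (ZSpan.fundamentalDomain (realLatticeBasis K))| ≤ C_b * L ^ (d - 1) := by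
    intro b _
    rw [card_fibre_eq K x₁ (α₀ + r b), ← hprod (realEmb K (α₀ + r b)), ← hcardR]
    exact hCb _ _ L hL1 (fibreLo_le_fibreHi K hN.le hs0) (hside _) _
      (pi_Ioo_subset_fibreBox K hs0) (fibreBox_subset_pi_Icc K hs0)
  -- sum up
  have hmain : (T.card : ℝ) * ((N ^ d / |(Algebra.norm ℚ (x₁ : K) : ℝ)|) /
      volume.real (ZSpan.fundamentalDomain (realLatticeBasis K))) =
      ((Ideal.absNorm (Ideal.span ({x₁} : Set (𝓞 K))) : ℝ) / n) /
        (|(Algebra.norm ℚ (x₁ : K) : ℝ)| * volume.real (ZSpan.fundamentalDomain (realLatticeBasis K))) *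
          N ^ d := by
    rw [hTcard]; ring
  rw [← hmain]
  have hsum : ∑ b ∈ T, (Nat.card {γ : 𝓞 K // α₀ + r b + x₁ * γ ∈ box₀ K N} : ℝ) -
      (T.card : ℝ) * ((N ^ d / |(Algebra.norm ℚ (x₁ : K) : ℝ)|) /
        volume.real (ZSpan.fundamentalDomain (realLatticeBasis K))) =
      ∑ b ∈ T, ((Nat.card {γ : 𝓞 K // α₀ + r b + x₁ * γ ∈ box₀ K N} : ℝ) -
        (N ^ d / |(Algebra.norm ℚ (x₁ : K) : ℝ)|) /
          volume.real (ZSpan.fundamentalDomain (realLatticeBasis K))) := by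
    rw [Finset.sum_sub_distrib, Finset.sum_const, nsmul_eq_mul]
  rw [hsum]
  calc |∑ b ∈ T, ((Nat.card {γ : 𝓞 K // α₀ + r b + x₁ * γ ∈ box₀ K N} : ℝ) -
        (N ^ d / |(Algebra.norm ℚ (x₁ : K) : ℝ)|) /
          volume.real (ZSpan.fundamentalDomain (realLatticeBasis K)))|
      ≤ ∑ b ∈ T, |(Nat.card {γ : 𝓞 K // α₀ + r b + x₁ * γ ∈ box₀ K N} : ℝ) -
        (N ^ d / |(Algebra.norm ℚ (x₁ : K) : ℝ)|) /
          volume.real (ZSpan.fundamentalDomain (realLatticeBasis K))| := Finset.abs_sum_le_sum_abs _ _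
    _ ≤ ∑ b ∈ T, C_b * L ^ (d - 1) := Finset.sum_le_sum hterm
    _ = (T.card : ℝ) * (C_b * L ^ (d - 1)) := by rw [Finset.sum_const, nsmul_eq_mul]
    _ = ((Ideal.absNorm (Ideal.span ({x₁} : Set (𝓞 K))) : ℝ) / n) * C_b * L ^ (d - 1) := by
        rw [hTcard]; ring

end Uniform

section Final

variable [IsTotallyReal K]

omit [IsTotallyReal K] in
/-- `(N(span{x}) : ℝ) = |N_{K/ℚ}(x)|`. [folklore] -/
theorem absNorm_span_singleton_real (x : 𝓞 K) :
    (Ideal.absNorm (Ideal.span ({x} : Set (𝓞 K))) : ℝ) = |(Algebra.norm ℚ (x : K) : ℝ)| := by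
  rw [Ideal.absNorm_span_singleton, Nat.cast_natAbs, Int.cast_abs, ← Algebra.coe_norm_int]
  push_cast
  rfl

omit [NumberField K] [IsTotallyReal K] in
/-- If `|a − b| ≤ C/N` for all `N ≥ 1` then `a = b`. [folklore] -/
theorem eq_of_forall_abs_sub_le_div {a b C : ℝ} (h : ∀ N : ℝ, 1 ≤ N → |a - b| ≤ C / N) : a = b := by
  by_contra hab
  have hpos : 0 < |a - b| := abs_pos.2 (sub_ne_zero.2 hab)
  have hC : 0 ≤ C := by
    have := h 1 le_rfl; rw [div_one] at this; linarith
  set N : ℝ := C / |a - b| + 1 with hN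
  have hN1 : 1 ≤ N := by rw [hN]; have := div_nonneg hC hpos.le; linarith
  have hNpos : 0 < N := by linarith
  have h1 := h N hN1
  rw [le_div_iff₀ hNpos] at h1
  have : |a - b| * N = C + |a - b| := by rw [hN]; field_simp
  linarith

/-- **The residue-class count in the box, uniformly in the modulus** (§2.1: "the number of
elements `α ∈ A(N)` satisfying `α ≡ α₀ (mod 𝔮)` is `|A(N)|/|𝔮| + O(|∂A(N, 𝔮)|)`,
`|∂A(N, 𝔮)| ≪ 1 + (|A(N)|/|𝔮|)^{1−1/d}`", for the box `A₀(N)` of a totally real `K`): there is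
`C = C(K)` with `|#{α ∈ A₀(N) : α ≡ α₀ (mod 𝔮)} − N^d/(N𝔮 √|D_K|)| ≤ C (1 + (N^d/N𝔮)^{1−1/d})` for every
nonzero ideal `𝔮`, every `N ≥ 1` and every `α₀`. Proof: a Minkowski-short `x₁ ∈ 𝔮` (all
`|σ x₁| < c₁ N𝔮^{1/d}`, so `|N x₁| < c₁^d N𝔮` and `|σ x₁| > c₁^{1−d} N𝔮^{1/d}`); fibre `α₀ + 𝔮` over
`𝔮/(x₁)` (`< c₁^d` classes); each fibre is the fixed lattice `ι(𝓞_K)` in a coordinate box of sides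
`≤ c₁^{d−1} (N^d/N𝔮)^{1/d}` (`abs_card_inter_coordBox_sub_le`); the constant `vol(P) = √|D_K|` is
identified through the fixed-`𝔮` count `abs_card_box₀_sub_le`.
[cite: CastilloEtAl2015, §2.1 (count of α ∈ A(N) with α ≡ α₀ mod 𝔮, |∂A(N,𝔮)| ≪ 1 + (|A(N)|/|𝔮|)^{1−1/d})] -/
theorem abs_card_box₀_coset_sub_le_uniform :
    ∃ C : ℝ, ∀ (𝔮 : (Ideal (𝓞 K))⁰) (N : ℝ), 1 ≤ N → ∀ α₀ : 𝓞 K,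
      |(Nat.card {α : 𝓞 K // α ∈ box₀ K N ∧ α - α₀ ∈ (𝔮 : Ideal (𝓞 K))} : ℝ) -
          N ^ finrank ℚ K / (Ideal.absNorm (𝔮 : Ideal (𝓞 K)) * √|discr K|)| ≤
        C * (1 + (N ^ finrank ℚ K / Ideal.absNorm (𝔮 : Ideal (𝓞 K))) ^
          (1 - 1 / (finrank ℚ K : ℝ))) := by
  haveI := nonempty_isReal (K := K)
  set d : ℕ := finrank ℚ K with hd
  have hd0 : 0 < d := finrank_pos
  have hd1 : 1 ≤ d := hd0
  have hdR : (0 : ℝ) < d := by exact_mod_cast hd0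
  -- the short vectors
  obtain ⟨c₁', hc₁', hmin⟩ := exists_ne_zero_mem_ideal_forall_lt K
  set c₁ : ℝ := max c₁' 1 with hc₁def
  have hc₁1 : 1 ≤ c₁ := le_max_right _ _
  have hc₁0 : 0 < c₁ := by linarith
  -- the uniform count for the fixed real lattice
  obtain ⟨C_b, hCb⟩ :=
    Literature.Algebra.EuclideanLattices.abs_card_inter_coordBox_sub_le (realLatticeBasis K)
  set V : ℝ := volume.real (ZSpan.fundamentalDomain (realLatticeBasis K)) with hVdef
  have hV0 : 0 < V := Literature.Algebra.EuclideanLattices.measureReal_fundamentalDomain_pos _ _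
  have hcardR : Fintype.card {w : InfinitePlace K // w.IsReal} = d := by
    rw [hd, IsTotallyReal.finrank]
  set D : ℝ := √|((discr K : ℤ) : ℝ)| with hDdef
  set C_A : ℝ := c₁ ^ d * |C_b| * c₁ ^ ((d - 1) * (d - 1)) with hCA
  -- Step A: uniform bound with main term `N^d/(N𝔮 · V)`
  have hunif : ∀ (𝔮 : (Ideal (𝓞 K))⁰) (N : ℝ), 1 ≤ N → ∀ α₀ : 𝓞 K,
      |(Nat.card {α : 𝓞 K // α ∈ box₀ K N ∧ α - α₀ ∈ (𝔮 : Ideal (𝓞 K))} : ℝ) -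
          N ^ d / (Ideal.absNorm (𝔮 : Ideal (𝓞 K)) * V)| ≤
        C_A * (1 + (N ^ d / Ideal.absNorm (𝔮 : Ideal (𝓞 K))) ^ (1 - 1 / (d : ℝ))) := by
    intro 𝔮 N hN α₀
    have hN0 : 0 < N := by linarith
    set n : ℝ := (Ideal.absNorm (𝔮 : Ideal (𝓞 K)) : ℝ) with hn
    have hn1 : 1 ≤ n := by
      rw [hn]; exact_mod_cast Nat.one_le_iff_ne_zero.2 (Ideal.absNorm_ne_zero_of_nonZeroDivisors 𝔮)
    have hn0 : 0 < n := by linarith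
    obtain ⟨x₁, hx₁, hx₁0, hlt'⟩ := hmin 𝔮
    set C₀ : ℝ := c₁ * n ^ (1 / (d : ℝ)) with hC₀
    have hlt : ∀ w : InfinitePlace K, w (x₁ : K) < C₀ := fun w =>
      (hlt' w).trans_le (by rw [hC₀]; gcongr; exact le_max_left _ _)
    have hper := abs_card_box₀_coset_sub_le_of_short K hCb hx₁0 hx₁ hlt hN0 α₀
    -- the main coefficient is `1/(n V)`
    have hA0 : 0 < |(Algebra.norm ℚ (x₁ : K) : ℝ)| := by
      rw [← absNorm_span_singleton_real]
      exact_mod_cast Nat.pos_of_ne_zero (by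
        rw [Ne, Ideal.absNorm_eq_zero_iff, Ideal.span_singleton_eq_bot]; exact hx₁0)
    have hcoef : ((Ideal.absNorm (Ideal.span ({x₁} : Set (𝓞 K))) : ℝ) / n) /
        (|(Algebra.norm ℚ (x₁ : K) : ℝ)| * V) * N ^ d = N ^ d / (n * V) := by
      rw [absNorm_span_singleton_real]
      field_simp
    rw [hcoef] at hper
    refine hper.trans ?_
    -- bound the index `|N x₁|/n ≤ c₁^d`
    have hrpow_d : (n ^ (1 / (d : ℝ))) ^ d = n := by
      rw [one_div, Real.rpow_inv_natCast_pow hn0.le hd0.ne']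
    have hindex : (Ideal.absNorm (Ideal.span ({x₁} : Set (𝓞 K))) : ℝ) / n ≤ c₁ ^ d := by
      rw [absNorm_span_singleton_real, div_le_iff₀ hn0, ← prod_isReal_apply_eq_abs_norm]
      calc ∏ w : {w : InfinitePlace K // w.IsReal}, w.1 (x₁ : K)
          ≤ ∏ _w : {w : InfinitePlace K // w.IsReal}, C₀ :=
            Finset.prod_le_prod (fun w _ => apply_nonneg _ _) fun w _ => (hlt w.1).le
        _ = C₀ ^ d := by rw [Finset.prod_const, Finset.card_univ, hcardR]
        _ = c₁ ^ d * n := by rw [hC₀, mul_pow, hrpow_d]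
    -- bound `L^{d-1}`
    set u : ℝ := N ^ d / n with hu
    have hu0 : 0 ≤ u := by positivity
    set v : ℝ := u ^ (1 / (d : ℝ)) with hv
    have hv0 : 0 ≤ v := by positivity
    have hvpow : v ^ (d - 1) = u ^ (1 - 1 / (d : ℝ)) := by
      rw [hv, ← Real.rpow_natCast, ← Real.rpow_mul hu0, Nat.cast_sub hd1, Nat.cast_one,
        one_div_mul_eq_div, sub_div, div_self hdR.ne']
    have hside_eq : N * C₀ ^ (d - 1) / n = c₁ ^ (d - 1) * v := by
      have h1 : C₀ ^ (d - 1) = c₁ ^ (d - 1) * n ^ ((d - 1 : ℕ) * (1 / (d : ℝ))) := by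
        rw [hC₀, mul_pow, ← Real.rpow_natCast (n ^ (1 / (d : ℝ))), ← Real.rpow_mul hn0.le,
          mul_comm (1 / (d : ℝ))]
      have h2 : v = N / n ^ (1 / (d : ℝ)) := by
        rw [hv, hu, Real.div_rpow (by positivity) hn0.le, ← Real.rpow_natCast N,
          ← Real.rpow_mul hN0.le, mul_one_div_cancel hdR.ne', Real.rpow_one]
      rw [h1, h2, Nat.cast_sub hd1, Nat.cast_one, sub_mul, one_mul, mul_one_div_cancel hdR.ne',
        Real.rpow_sub hn0, Real.rpow_one]
      field_simp
    have hL : max 1 (N * C₀ ^ (d - 1) / n) ≤ c₁ ^ (d - 1) * max 1 v := by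
      rw [hside_eq]
      have hc : 1 ≤ c₁ ^ (d - 1) := one_le_pow₀ hc₁1
      refine max_le ?_ ?_
      · calc (1 : ℝ) = 1 * 1 := (mul_one _).symm
          _ ≤ c₁ ^ (d - 1) * max 1 v := mul_le_mul hc (le_max_left _ _) zero_le_one (by positivity)
      · exact mul_le_mul_of_nonneg_left (le_max_right _ _) (by positivity)
    have hLpow : (max 1 (N * C₀ ^ (d - 1) / n)) ^ (d - 1) ≤
        c₁ ^ ((d - 1) * (d - 1)) * (1 + u ^ (1 - 1 / (d : ℝ))) := by
      calc (max 1 (N * C₀ ^ (d - 1) / n)) ^ (d - 1) ≤ (c₁ ^ (d - 1) * max 1 v) ^ (d - 1) :=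
            pow_le_pow_left₀ (by positivity) hL _
        _ = c₁ ^ ((d - 1) * (d - 1)) * (max 1 v) ^ (d - 1) := by rw [mul_pow, ← pow_mul]
        _ ≤ c₁ ^ ((d - 1) * (d - 1)) * (1 + v ^ (d - 1)) := by
            refine mul_le_mul_of_nonneg_left ?_ (by positivity)
            -- `(max 1 v)^k ≤ 1 + v^k` (as in `LongRangeIsing.max_one_pow_le`)
            rcases le_total v 1 with h | h
            · rw [max_eq_left h, one_pow]; linarith [pow_nonneg hv0 (d - 1)]
            · rw [max_eq_right h]; linarith
        _ = c₁ ^ ((d - 1) * (d - 1)) * (1 + u ^ (1 - 1 / (d : ℝ))) := by rw [hvpow]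
    -- assemble
    have hCb' : C_b ≤ |C_b| := le_abs_self _
    calc (Ideal.absNorm (Ideal.span ({x₁} : Set (𝓞 K))) : ℝ) / n * C_b *
          (max 1 (N * C₀ ^ (d - 1) / n)) ^ (d - 1)
        ≤ c₁ ^ d * |C_b| * (c₁ ^ ((d - 1) * (d - 1)) * (1 + u ^ (1 - 1 / (d : ℝ)))) := by
          have h1 : (Ideal.absNorm (Ideal.span ({x₁} : Set (𝓞 K))) : ℝ) / n * C_b ≤
              (Ideal.absNorm (Ideal.span ({x₁} : Set (𝓞 K))) : ℝ) / n * |C_b| :=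
            mul_le_mul_of_nonneg_left hCb' (by positivity)
          have h2 : (Ideal.absNorm (Ideal.span ({x₁} : Set (𝓞 K))) : ℝ) / n * |C_b| ≤
              c₁ ^ d * |C_b| := mul_le_mul_of_nonneg_right hindex (abs_nonneg _)
          calc _ ≤ (Ideal.absNorm (Ideal.span ({x₁} : Set (𝓞 K))) : ℝ) / n * |C_b| *
                (max 1 (N * C₀ ^ (d - 1) / n)) ^ (d - 1) :=
                mul_le_mul_of_nonneg_right h1 (by positivity)
            _ ≤ c₁ ^ d * |C_b| * (max 1 (N * C₀ ^ (d - 1) / n)) ^ (d - 1) :=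
                mul_le_mul_of_nonneg_right h2 (by positivity)
            _ ≤ c₁ ^ d * |C_b| * (c₁ ^ ((d - 1) * (d - 1)) * (1 + u ^ (1 - 1 / (d : ℝ)))) :=
                mul_le_mul_of_nonneg_left hLpow (by positivity)
      _ = C_A * (1 + u ^ (1 - 1 / (d : ℝ))) := by rw [hCA]; ring
  -- Step B: `V = √|D_K|`, by comparison with the fixed-`𝔮` count at `𝔮 = 1`, `α₀ = 0`
  obtain ⟨C', hC'⟩ := abs_card_box₀_sub_le (K := K)
  have hD0 : 0 < D :=
    Real.sqrt_pos.2 (abs_pos.2 (Int.cast_ne_zero.2 (discr_ne_zero K)))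
  have hVD : V⁻¹ = (D)⁻¹ := by
    refine eq_of_forall_abs_sub_le_div (C := 2 * C_A + C') fun N hN => ?_
    have hN0 : 0 < N := by linarith
    have h1 := hunif 1 N hN 0
    have h2 := hC' N hN
    have hcard : Nat.card {α : 𝓞 K // α ∈ box₀ K N ∧ α - 0 ∈ ((1 : (Ideal (𝓞 K))⁰) : Ideal (𝓞 K))} =
        Nat.card (box₀ K N) := Nat.card_congr (Equiv.subtypeEquivRight fun α => by simp)
    rw [hcard] at h1
    simp only [OneMemClass.coe_one, Ideal.one_eq_top, Ideal.absNorm_top, Nat.cast_one, one_mul,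
      div_one] at h1
    -- `(N^d)^{1-1/d} = N^{d-1} ≤ N^d / N`-type bookkeeping: bound both errors by `(2 C_A + C') N^{d-1}`
    have hpow : (N ^ d : ℝ) ^ (1 - 1 / (d : ℝ)) = N ^ (d - 1) := by
      rw [← Real.rpow_natCast N d, ← Real.rpow_mul hN0.le, ← Real.rpow_natCast N (d - 1),
        Nat.cast_sub hd1, Nat.cast_one, mul_sub, mul_one, mul_one_div_cancel hdR.ne']
    rw [hpow] at h1
    have hNd1 : (1 : ℝ) ≤ N ^ (d - 1) := one_le_pow₀ hN
    have hCA0 : 0 ≤ C_A := by rw [hCA]; positivity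
    have hdiff : |N ^ d / V - N ^ d / D| ≤ (2 * C_A + C') * N ^ (d - 1) := by
      calc |N ^ d / V - N ^ d / D|
          ≤ |(Nat.card (box₀ K N) : ℝ) - N ^ d / V| +
              |(Nat.card (box₀ K N) : ℝ) - N ^ d / D| := by
            rw [abs_sub_comm ((Nat.card (box₀ K N) : ℝ)) (N ^ d / V)]
            exact abs_sub_le _ _ _
        _ ≤ C_A * (1 + N ^ (d - 1)) + C' * N ^ (d - 1) := add_le_add h1 h2
        _ ≤ C_A * (N ^ (d - 1) + N ^ (d - 1)) + C' * N ^ (d - 1) := by gcongr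
        _ = (2 * C_A + C') * N ^ (d - 1) := by ring
    have hNd : (0 : ℝ) < N ^ d := by positivity
    have hkey : |V⁻¹ - (D)⁻¹| * N ^ d ≤ (2 * C_A + C') * N ^ (d - 1) := by
      have heq : N ^ d / V - N ^ d / D = (V⁻¹ - (D)⁻¹) * N ^ d := by ring
      rw [heq, abs_mul, abs_of_pos hNd] at hdiff
      exact hdiff
    rw [le_div_iff₀ hN0]
    have hNsplit : (N : ℝ) ^ d = N ^ (d - 1) * N := by
      rw [← pow_succ, Nat.sub_add_cancel hd1]
    rw [hNsplit, ← mul_assoc] at hkey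
    have hNd1pos : (0 : ℝ) < N ^ (d - 1) := by positivity
    nlinarith [hkey, abs_nonneg (V⁻¹ - (D)⁻¹)]
  have hV : V = D := inv_injective hVD
  refine ⟨C_A, fun 𝔮 N hN α₀ => ?_⟩
  have h := hunif 𝔮 N hN α₀
  rwa [hV] at h

end Final


end UniformCount

/-! ## The same for `A(N) = A₀(2N) ∖ A₀(N)` -/

section BoxDifference

open NumberField NumberField.InfinitePlace Set Module
open scoped nonZeroDivisors Classical

variable (K : Type*) [Field K] [NumberField K]

/-- The count on `A(N) = A₀(2N) ∖ A₀(N)` is the difference of the counts on `A₀(2N)` and `A₀(N)`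
(`N ≥ 0`). [cite: CastilloEtAl2015, §2.1 (A(N) = A₀(2N) ∖ A₀(N))] -/
theorem card_box_coset_eq {N : ℝ} (hN : 0 ≤ N) (𝔮 : Ideal (𝓞 K)) (α₀ : 𝓞 K) :
    (Nat.card {α : 𝓞 K // α ∈ box K N ∧ α - α₀ ∈ 𝔮} : ℝ) =
      Nat.card {α : 𝓞 K // α ∈ box₀ K (2 * N) ∧ α - α₀ ∈ 𝔮} -
        Nat.card {α : 𝓞 K // α ∈ box₀ K N ∧ α - α₀ ∈ 𝔮} := by
  set S₁ : Set (𝓞 K) := {α | α ∈ box₀ K N ∧ α - α₀ ∈ 𝔮} with hS₁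
  set S₂ : Set (𝓞 K) := {α | α ∈ box₀ K (2 * N) ∧ α - α₀ ∈ 𝔮} with hS₂
  have hsub : S₁ ⊆ S₂ := fun α h => ⟨box₀_mono (by linarith) h.1, h.2⟩
  have hfin₁ : S₁.Finite := (finite_box₀ N).subset fun α h => h.1
  have hfin₂ : S₂.Finite := (finite_box₀ (2 * N)).subset fun α h => h.1
  have hdiff : {α : 𝓞 K | α ∈ box K N ∧ α - α₀ ∈ 𝔮} = S₂ \ S₁ := by
    ext α
    simp only [box, Set.mem_sdiff, Set.mem_setOf_eq, hS₁, hS₂]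
    tauto
  have h1 : Nat.card {α : 𝓞 K // α ∈ box K N ∧ α - α₀ ∈ 𝔮} = (S₂ \ S₁).ncard := by
    rw [← Nat.card_coe_set_eq, ← hdiff]; rfl
  have h2 : Nat.card {α : 𝓞 K // α ∈ box₀ K (2 * N) ∧ α - α₀ ∈ 𝔮} = S₂.ncard := by
    rw [← Nat.card_coe_set_eq]; rfl
  have h3 : Nat.card {α : 𝓞 K // α ∈ box₀ K N ∧ α - α₀ ∈ 𝔮} = S₁.ncard := by
    rw [← Nat.card_coe_set_eq]; rfl
  rw [h1, h2, h3, Set.ncard_sdiff hsub hfin₁, Nat.cast_sub (Set.ncard_le_ncard hsub hfin₂)]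

/-- **The residue-class count in `A(N)`, uniformly in the modulus** (§2.1 as printed: "the number of
elements `α ∈ A(N)` satisfying `α ≡ α₀ (mod 𝔮)` is `|A(N)|/|𝔮| + O(|∂A(N, 𝔮)|)`,
`|∂A(N, 𝔮)| ≪ 1 + (|A(N)|/|𝔮|)^{1−1/d}`", `|A(N)| ∼ (2^d − 1)N^d/√|D|`), for totally real `K`:
`|#{α ∈ A(N) : α ≡ α₀ (𝔮)} − (2^d − 1)N^d/(N𝔮√|D_K|)| ≤ C (1 + (N^d/N𝔮)^{1−1/d})` for all nonzero `𝔮`,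
`N ≥ 1`, `α₀`. [cite: CastilloEtAl2015, §2.1 (|∂A(N,𝔮)| ≪ 1 + (|A(N)|/|𝔮|)^{1−1/d})] -/
theorem abs_card_box_coset_sub_le_uniform [IsTotallyReal K] :
    ∃ C : ℝ, ∀ (𝔮 : (Ideal (𝓞 K))⁰) (N : ℝ), 1 ≤ N → ∀ α₀ : 𝓞 K,
      |(Nat.card {α : 𝓞 K // α ∈ box K N ∧ α - α₀ ∈ (𝔮 : Ideal (𝓞 K))} : ℝ) -
          (2 ^ finrank ℚ K - 1) * N ^ finrank ℚ K /
            (Ideal.absNorm (𝔮 : Ideal (𝓞 K)) * √|discr K|)| ≤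
        C * (1 + (N ^ finrank ℚ K / Ideal.absNorm (𝔮 : Ideal (𝓞 K))) ^
          (1 - 1 / (finrank ℚ K : ℝ))) := by
  obtain ⟨C, hC⟩ := abs_card_box₀_coset_sub_le_uniform K
  set d : ℕ := finrank ℚ K with hd
  have hd0 : 0 < d := finrank_pos
  have hdR : (0 : ℝ) < d := by exact_mod_cast hd0
  refine ⟨|C| * (2 ^ d + 1), fun 𝔮 N hN α₀ => ?_⟩
  have hN0 : 0 ≤ N := by linarith
  set n : ℝ := (Ideal.absNorm (𝔮 : Ideal (𝓞 K)) : ℝ) with hn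
  have hn0 : 0 < n := by
    rw [hn]; exact_mod_cast Nat.pos_of_ne_zero (Ideal.absNorm_ne_zero_of_nonZeroDivisors 𝔮)
  set D : ℝ := √|((discr K : ℤ) : ℝ)| with hD
  set u : ℝ := N ^ d / n with hu
  have hu0 : 0 ≤ u := by positivity
  set e : ℝ := 1 - 1 / (d : ℝ) with he
  have he0 : 0 ≤ e := by
    rw [he, sub_nonneg, div_le_one hdR]; exact_mod_cast hd0
  have he1 : e ≤ 1 := by rw [he]; linarith [one_div_pos.2 hdR]
  have h2 := hC 𝔮 (2 * N) (by linarith) α₀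
  have h1 := hC 𝔮 N hN α₀
  rw [card_box_coset_eq K hN0]
  -- `((2N)^d/n)^e ≤ 2^d u^e`
  have hpow2 : ((2 * N) ^ d / n) ^ e ≤ 2 ^ d * u ^ e := by
    rw [mul_pow, mul_div_assoc, Real.mul_rpow (by positivity) hu0]
    refine mul_le_mul_of_nonneg_right ?_ (by positivity)
    calc ((2 : ℝ) ^ d) ^ e ≤ ((2 : ℝ) ^ d) ^ (1 : ℝ) :=
          Real.rpow_le_rpow_of_exponent_le (one_le_pow₀ (by norm_num)) he1
      _ = 2 ^ d := Real.rpow_one _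
  have hCabs : C ≤ |C| := le_abs_self C
  have h2' : |(Nat.card {α : 𝓞 K // α ∈ box₀ K (2 * N) ∧ α - α₀ ∈ (𝔮 : Ideal (𝓞 K))} : ℝ) -
      (2 * N) ^ d / (n * D)| ≤ |C| * (1 + 2 ^ d * u ^ e) := by
    refine h2.trans ?_
    calc C * (1 + ((2 * N) ^ d / n) ^ e) ≤ |C| * (1 + ((2 * N) ^ d / n) ^ e) :=
          mul_le_mul_of_nonneg_right hCabs (by positivity)
      _ ≤ |C| * (1 + 2 ^ d * u ^ e) := by gcongr
  have h1' : |(Nat.card {α : 𝓞 K // α ∈ box₀ K N ∧ α - α₀ ∈ (𝔮 : Ideal (𝓞 K))} : ℝ) -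
      N ^ d / (n * D)| ≤ |C| * (1 + u ^ e) :=
    h1.trans (mul_le_mul_of_nonneg_right hCabs (by positivity))
  have hsplit : (Nat.card {α : 𝓞 K // α ∈ box₀ K (2 * N) ∧ α - α₀ ∈ (𝔮 : Ideal (𝓞 K))} : ℝ) -
      (Nat.card {α : 𝓞 K // α ∈ box₀ K N ∧ α - α₀ ∈ (𝔮 : Ideal (𝓞 K))} : ℝ) -
        (2 ^ d - 1) * N ^ d / (n * D) =
      ((Nat.card {α : 𝓞 K // α ∈ box₀ K (2 * N) ∧ α - α₀ ∈ (𝔮 : Ideal (𝓞 K))} : ℝ) -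
        (2 * N) ^ d / (n * D)) -
      ((Nat.card {α : 𝓞 K // α ∈ box₀ K N ∧ α - α₀ ∈ (𝔮 : Ideal (𝓞 K))} : ℝ) - N ^ d / (n * D)) := by
    rw [mul_pow]; ring
  rw [hsplit]
  calc _ ≤ |C| * (1 + 2 ^ d * u ^ e) + |C| * (1 + u ^ e) := (abs_sub _ _).trans (add_le_add h2' h1')
    _ = |C| * 2 + |C| * (2 ^ d + 1) * u ^ e := by ring
    _ ≤ |C| * (2 ^ d + 1) + |C| * (2 ^ d + 1) * u ^ e := by
        have : (2 : ℝ) ≤ 2 ^ d + 1 := by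
          have : (1 : ℝ) ≤ 2 ^ d := one_le_pow₀ (by norm_num)
          linarith
        nlinarith [abs_nonneg C]
    _ = |C| * (2 ^ d + 1) * (1 + u ^ e) := by ring


end BoxDifference

end CastilloEtAl2015

/-- **Castillo–Hall–Lemke Oliver–Pollack–Thompson 2015, Theorem 1.1 (`m = 2`, `k₀ = 105`) for the
totally real field `K = ℚ`** — the statement of `castilloEtAl2015_thm_1_1_totallyReal` verbatim at
`K = ℚ`, PROVED: for every finite `H ⊆ 𝓞 ℚ` with `|H| ≥ 105` missing a residue class modulo every prime
ideal there are infinitely many `α ∈ 𝓞 ℚ` with `α + h₁`, `α + h₂` prime for two distinct `h₁, h₂ ∈ H`.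
From the case `A = ℤ` (`CastilloEtAl2015.infinite_int`: Bombieri–Vinogradov, `M₁₀₅ > 4`, Maynard's
Prop. 4.2) transported along `𝓞 ℚ ≃+* ℤ` and the reduction `k ≥ 105 ⟸ k = 105`.
[cite: CastilloEtAl2015, Theorem 1.1 with Remark 1, Corollary 2.6 and §3.1 (the case K = ℚ)] -/
theorem castilloEtAl2015_thm_1_1_rat (H : Finset (NumberField.RingOfIntegers ℚ)) (hcard : 105 ≤ H.card)
    (hH : ∀ P : Ideal (NumberField.RingOfIntegers ℚ), P.IsPrime →
      ∃ a : NumberField.RingOfIntegers ℚ, ∀ h ∈ H, a - h ∉ P) :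
    {α : NumberField.RingOfIntegers ℚ |
      ∃ h₁ ∈ H, ∃ h₂ ∈ H, h₁ ≠ h₂ ∧ Prime (α + h₁) ∧ Prime (α + h₂)}.Infinite :=
  CastilloEtAl2015.infinite_of_forall_card_eq
    (fun H' hcard' hH' =>
      CastilloEtAl2015.infinite_of_ringEquiv Rat.ringOfIntegersEquiv
        CastilloEtAl2015.infinite_int H' hcard' hH')
    H hcard hH

end Literature.NumberTheory.Sieve
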